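import Literature.Computability.FineGrained.FineGrainedWave0
import HarnessLib

/-!
# The sparsification lemma of Impagliazzo–Paturi–Zane: the combinatorial core, proved

Family `fine-grained` (trunk T-CPLX-FINE). This is the sibling "proofs" file of
`Literature/Computability/FineGrained/FineGrainedWave0.lean` for the named fact
`Literature.Computability.FineGrained.sparsification` (**fine-grained.S05**; Impagliazzo–Paturi–Zane, *Which problems
have strongly exponential complexity?*, JCSS 63 (2001) 512–530, §2, Theorem 1 and Corollary 1).

The named fact bundles two assertions about one function `F : KCNF k → List (KCNF k)`:

* (combinatorial) `F φ` is a list of at most `2^{ε n}` k-CNFs on the `n` variables of `φ`, each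
  with at most `C · n` clauses, whose disjunction is equivalent to `φ` — Corollary 1 of the source
  without its last sentence;
* (algorithmic) `F` is computed by a multi-stack Turing machine (`Turing.FinTM2`) within
  `O(2^{ε n} · poly(L))` steps — the "Moreover" sentence of Corollary 1.

This file proves the **combinatorial** half completely, following the printed proof (§2, algorithm
`Reduce` and Lemmas 1–7):

* `Sparsification.IPZ2001_theorem1` — Theorem 1 in its set-cover form (existence part): for all
  `k` and `ε > 0` there is `C` such that every family `S` of sets of size `≤ k` over an `n`-element
  universe has a list of at most `2^{ε n}` restrictions `T₁, …, T_t`, each of at most `C · n` sets,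
  every member of each `T_l` being a subset of a member of `S`, with `σ(S) = ⋃ σ(T_l)` (same
  covers);
* `IPZ2001_corollary1` / `IPZ2001_corollary1_holds` — Corollary 1 for `KCNF k` (existence part),
  stated *verbatim* as the first conjunct of `sparsification`.

The algorithmic half (a time-bounded `Turing.FinTM2` implementing `Reduce`) needs a verified
complexity framework for multi-stack machines that Mathlib does not have (Mathlib's
`Turing.PartrecToTM2` compiles code to `TM2` without any time analysis); `sparsification` itself
therefore stays a named fact, now reduced to that routine-but-unformalised implementation claim.

## The printed proof and the proof given here

`Reduce` (IPZ §2) repeatedly replaces the current family `S` by its antichain of minimal members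
`Θ(S)` and, as long as `Θ(S)` contains a large *weak sunflower* — `c ≥ θᵢ` sets of a common
size `j`, sharing a nonempty *heart* `H`, with *petals* `S_d ∖ H` of size `i` — chosen first in the
loop order (`j` increasing, then `i` increasing), branches into `S ∪ {H}` and `S ∪ {petals}`;
sunflower-free families are output. We formalise exactly this recursion (`Sparsification.run`,
driven by any *valid* selection rule `Sparsification.IsValidStep`: "return a qualifying sunflower
that is minimal in the loop order, or report that none exists"; the rule may depend on the
position of the node in the tree, as it does for an implementation working on list
representations, and hearts are designated common subsets — both only enlarge the set of
admissible selections) and prove: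

* Lemma 1 (`covers_iff_exists_leaf`): `σ(S) = ⋃ σ(leaf)`;
* Lemma 2 (`card_filter_nonempty_le_of_terminal`): a sunflower-free antichain of sets of size
  `≤ k` has at most `(∑_{j<k} θ_j) · n` nonempty members;
* Lemmas 3–6 as one invariant of the recursion with history (`Sparsification.Inv`: the antichain
  and restriction properties, the degree invariant `J_i`, the count of eliminated added sets, and
  the petal-step budget), giving along every path at most `A_k · n` added sets and at most
  `k · ⌊n / M⌋` petal steps (`card_add_le`, `length_ps_le`);
* Lemma 7 with the binomial estimate replaced by the equivalent generating-function (Kraft-type)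
  induction `#leaves ≤ (1 + 1/y)^{adds left} · y^{petal steps left}` (`length_run_le`), and the
  final choice of parameters (`exists_good_params`): `θ_{i+1} = M · (2θ_i - 1)(1 + A_i)`,
  `A_{i+1} = A_i + (2θ_i - 1)(1 + A_i)`, `M = M(k, ε)` large, `y = 2^{ε M / 2k}`.

Corollary 1 is then Theorem 1 applied to the family of literal sets of the clauses over the
`2n` literals (the auxiliary sets `{x, x̄}` of the printed reduction are not needed, since Lemma 1
holds for every candidate cover, in particular for the set of true literals of an assignment).

## Design notes

* Nothing in `FineGrainedWave0.lean` is restated or weakened; `sparsification` keeps its meaning.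
* Degenerate instances: if `∅ ∈ S` (an empty clause) there is no cover and the output list is
  empty — this is forced by the printed bound `|T_l| ≤ C · n` at `n = 0`.
* All definitions of the machinery live in the namespace `Literature.FineGrained.Sparsification`; they
  are proof devices (the recursion tree of `Reduce` with its history), not library notions.
-/

namespace Literature.Computability.FineGrained

open Finset

namespace Sparsification

variable {α : Type*} [DecidableEq α]

/-! ### Covers and minimal members -/

/-- `Covers X F`: the set `X` meets every member of the family `F` (`X ∈ σ(F)`, a set cover of
the set-cover instance `F` in the sense of IPZ §2).
[cite: ImpagliazzoPaturiZaneJCSS2001, §2 (σ(S))] -/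
def Covers (X : Finset α) (F : Finset (Finset α)) : Prop :=
  ∀ s ∈ F, (s ∩ X).Nonempty

/-- `Θ(F)`: the members of `F` having no proper subset in `F` (an antichain).
[cite: ImpagliazzoPaturiZaneJCSS2001, §2 (the operator Θ)] -/
def minimals (F : Finset (Finset α)) : Finset (Finset α) :=
  F.filter fun s => ∀ t ∈ F, t ⊆ s → t = s

/-- Membership in `Θ(F)`. [folklore] -/
theorem mem_minimals {F : Finset (Finset α)} {s : Finset α} :
    s ∈ minimals F ↔ s ∈ F ∧ ∀ t ∈ F, t ⊆ s → t = s := by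
  simp [minimals]

/-- `Θ(F) ⊆ F`. [folklore] -/
theorem minimals_subset (F : Finset (Finset α)) : minimals F ⊆ F :=
  Finset.filter_subset _ _

/-- Every member of `F` contains a member of `Θ(F)`. [folklore] -/
theorem exists_mem_minimals_subset {F : Finset (Finset α)} {s : Finset α} (hs : s ∈ F) :
    ∃ t ∈ minimals F, t ⊆ s := by
  obtain ⟨t, ht, hmin⟩ :=
    (F.filter fun t => t ⊆ s).exists_min_image Finset.card ⟨s, by simp [hs]⟩
  simp only [Finset.mem_filter] at ht hmin
  refine ⟨t, mem_minimals.2 ⟨ht.1, fun u hu hut => ?_⟩, ht.2⟩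
  exact Finset.eq_of_subset_of_card_le hut (hmin u ⟨hu, hut.trans ht.2⟩)

/-- `Θ(F)` is an antichain. [folklore] -/
theorem minimals_antichain (F : Finset (Finset α)) :
    IsAntichain (· ⊆ ·) (minimals F : Set (Finset α)) := by
  intro s hs t ht hne hst
  have ht' := mem_minimals.1 (Finset.mem_coe.1 ht)
  exact hne (ht'.2 s (mem_minimals.1 (Finset.mem_coe.1 hs)).1 hst)

/-- A member of an antichain `F` that is not minimal in `F ∪ N` has a proper subset in `N`.
[folklore] -/
theorem exists_ssubset_of_not_mem_minimals {F N : Finset (Finset α)}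
    (hF : IsAntichain (· ⊆ ·) (F : Set (Finset α))) {c : Finset α} (hc : c ∈ F)
    (hc' : c ∉ minimals (F ∪ N)) : ∃ n ∈ N, n ⊂ c := by
  rw [mem_minimals] at hc'
  push Not at hc'
  obtain ⟨t, ht, htc, htne⟩ := hc' (mem_union_left _ hc)
  rcases mem_union.1 ht with ht | ht
  · exact absurd (hF.eq (Finset.mem_coe.2 ht) (Finset.mem_coe.2 hc) htc) htne
  · exact ⟨t, ht, Finset.ssubset_iff_subset_ne.2 ⟨htc, htne⟩⟩

/-- A *fresh* set (no member of the antichain `F` below it) that is minimal within `N` is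
minimal in `F ∪ N`. [folklore] -/
theorem mem_minimals_union_of_fresh {F N : Finset (Finset α)} {n : Finset α} (hn : n ∈ N)
    (hfresh : ∀ c ∈ F, ¬ c ⊆ n) (hN : ∀ m ∈ N, m ⊆ n → m = n) :
    n ∈ minimals (F ∪ N) := by
  refine mem_minimals.2 ⟨mem_union_right _ hn, fun t ht htn => ?_⟩
  rcases mem_union.1 ht with ht | ht
  · exact absurd htn (hfresh t ht)
  · exact hN t ht htn

/-- Covers of `Θ(F)` are the covers of `F`. [cite: ImpagliazzoPaturiZaneJCSS2001, §2] -/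
theorem covers_minimals_iff {X : Finset α} {F : Finset (Finset α)} :
    Covers X (minimals F) ↔ Covers X F := by
  refine ⟨fun h s hs => ?_, fun h s hs => h s (minimals_subset F hs)⟩
  obtain ⟨t, ht, hts⟩ := exists_mem_minimals_subset hs
  exact (h t ht).mono (Finset.inter_subset_inter hts (Subset.refl _))

/-- Covers of a union. [folklore] -/
theorem covers_union {X : Finset α} {F G : Finset (Finset α)} :
    Covers X (F ∪ G) ↔ Covers X F ∧ Covers X G := by
  simp only [Covers, mem_union, or_imp, forall_and]

/-! ### Weak sunflowers and the selection rule of `Reduce` -/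

/-- A candidate branching of `Reduce`: a designated nonempty *heart* `H`, a *petal size* `i`,
and the sets `W` of the weak sunflower (each of size `|H| + i`, each containing `H`).
[cite: ImpagliazzoPaturiZaneJCSS2001, §2 (weak sunflower, heart, petals)] -/
structure Branch (α : Type*) where
  /-- the heart -/
  H : Finset α
  /-- the petal size -/
  i : ℕ
  /-- the sets of the sunflower -/
  W : Finset (Finset α)

/-- The common size `j = |H| + i` of the sets of the sunflower.
[cite: ImpagliazzoPaturiZaneJCSS2001, §2] -/
def Branch.size (b : Branch α) : ℕ := b.H.card + b.i

/-- The petals `S_d ∖ H`. [cite: ImpagliazzoPaturiZaneJCSS2001, §2] -/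
def Branch.petals (b : Branch α) : Finset (Finset α) := b.W.image fun s => s \ b.H

/-- `Qual θ F b`: `b` is a weak sunflower of `F` on which `Reduce` may branch — its sets lie in
`F`, have size `|H| + i` and contain the nonempty heart `H`, the petal size `i` is positive, and
there are at least `θ i` of them. [cite: ImpagliazzoPaturiZaneJCSS2001, §2 (line 4 of Reduce)] -/
def Qual (θ : ℕ → ℕ) (F : Finset (Finset α)) (b : Branch α) : Prop :=
  b.W ⊆ F ∧ b.H.Nonempty ∧ 1 ≤ b.i ∧ θ b.i ≤ b.W.card ∧
    ∀ s ∈ b.W, b.H ⊆ s ∧ s.card = b.H.card + b.i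

/-- The loop order of `Reduce`: by set size `j`, then by petal size `i`.
[cite: ImpagliazzoPaturiZaneJCSS2001, §2 (lines 2–3 of Reduce)] -/
def Branch.LexLE (b b' : Branch α) : Prop :=
  b.size < b'.size ∨ (b.size = b'.size ∧ b.i ≤ b'.i)

/-- `IsValidStep θ step`: the selection rule `step` returns, on every family, a qualifying weak
sunflower that is first in the loop order, and `none` exactly when there is none.
[cite: ImpagliazzoPaturiZaneJCSS2001, §2 (Reduce)] -/
def IsValidStep (θ : ℕ → ℕ) (step : Finset (Finset α) → Option (Branch α)) : Prop :=
  ∀ F, (step F = none → ∀ b, ¬ Qual θ F b) ∧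
    ∀ b, step F = some b → Qual θ F b ∧ ∀ b', Qual θ F b' → b.LexLE b'

omit [DecidableEq α] in
/-- A valid selection rule exists (choice). [folklore] -/
theorem exists_isValidStep (θ : ℕ → ℕ) :
    ∃ step : Finset (Finset α) → Option (Branch α), IsValidStep θ step := by
  classical
  have key : ∀ F : Finset (Finset α), (∃ b, Qual θ F b) →
      ∃ b, Qual θ F b ∧ ∀ b', Qual θ F b' → b.LexLE b' := by
    rintro F ⟨b₀, hb₀⟩
    have hm : ∃ m, ∃ b, Qual θ F b ∧ b.size = m := ⟨_, b₀, hb₀, rfl⟩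
    obtain ⟨b₁, hb₁, hb₁m⟩ := Nat.find_spec hm
    have hi : ∃ i, ∃ b, Qual θ F b ∧ b.size = Nat.find hm ∧ b.i = i :=
      ⟨_, b₁, hb₁, hb₁m, rfl⟩
    obtain ⟨b, hb, hbm, hbi⟩ := Nat.find_spec hi
    refine ⟨b, hb, fun b' hb' => ?_⟩
    have h1 : Nat.find hm ≤ b'.size := Nat.find_min' hm ⟨b', hb', rfl⟩
    rcases lt_or_eq_of_le h1 with hlt | heq
    · exact Or.inl (hbm ▸ hlt)
    · refine Or.inr ⟨hbm.trans heq, ?_⟩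
      rw [hbi]
      exact Nat.find_min' hi ⟨b', hb', heq.symm, rfl⟩
  refine ⟨fun F => if h : ∃ b, Qual θ F b then some (Classical.choose (key F h)) else none,
    fun F => ⟨fun hF b hb => ?_, fun b hb => ?_⟩⟩
  · by_cases h : ∃ b, Qual θ F b
    · dsimp only at hF
      rw [dif_pos h] at hF
      exact absurd hF (by simp)
    · exact h ⟨b, hb⟩
  · by_cases h : ∃ b, Qual θ F b
    · dsimp only at hb
      rw [dif_pos h, Option.some.injEq] at hb
      rw [← hb]
      exact Classical.choose_spec (key F h)
    · dsimp only at hb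
      rw [dif_neg h] at hb
      exact absurd hb (by simp)

/-- The competitor sunflower "all `h`-sets through `x`, heart `{x}`" used in Lemmas 2 and 3.
[cite: ImpagliazzoPaturiZaneJCSS2001, §2 (proofs of Lemmas 2, 3)] -/
def unitBranch (F : Finset (Finset α)) (x : α) (h : ℕ) : Branch α :=
  ⟨{x}, h - 1, F.filter fun s => s.card = h ∧ x ∈ s⟩

/-- If `x` lies in at least `θ (h-1)` sets of size `h ≥ 2`, the competitor qualifies.
[cite: ImpagliazzoPaturiZaneJCSS2001, §2 (proof of Lemma 2)] -/
theorem qual_unitBranch {θ : ℕ → ℕ} {F : Finset (Finset α)} {x : α} {h : ℕ}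
    (h2 : 2 ≤ h) (hc : θ (h - 1) ≤ (F.filter fun s => s.card = h ∧ x ∈ s).card) :
    Qual θ F (unitBranch F x h) := by
  refine ⟨filter_subset _ _, singleton_nonempty x, by simp [unitBranch]; omega, hc, ?_⟩
  intro s hs
  simp only [unitBranch, mem_filter] at hs
  refine ⟨singleton_subset_iff.2 hs.2.2, ?_⟩
  simp only [unitBranch, card_singleton]
  omega

/-- The competitor has set size `h`. [folklore] -/
theorem size_unitBranch (F : Finset (Finset α)) (x : α) {h : ℕ} (h1 : 1 ≤ h) :
    (unitBranch F x h).size = h := by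
  simp [unitBranch, Branch.size]; omega

/-- (†) If the selected sunflower `b` is first in the loop order, then below its set size no
element lies in `θ_{h-1}` sets of size `h ≥ 2`.
[cite: ImpagliazzoPaturiZaneJCSS2001, §2 (proof of Lemma 3, "there is no sunflower of i-sets")] -/
theorem card_filter_le_of_lexMin {θ : ℕ → ℕ} {F : Finset (Finset α)} {b : Branch α}
    (hmin : ∀ b', Qual θ F b' → b.LexLE b') {h : ℕ} (h2 : 2 ≤ h) (hlt : h < b.size)
    (x : α) :
    (F.filter fun s => s.card = h ∧ x ∈ s).card ≤ θ (h - 1) - 1 := by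
  by_contra hcon
  have hq := qual_unitBranch (θ := θ) (F := F) (x := x) h2 (by omega)
  rcases hmin _ hq with hlt' | ⟨heq, -⟩
  · rw [size_unitBranch F x (by omega)] at hlt'; omega
  · rw [size_unitBranch F x (by omega)] at heq; omega

/-- At a sunflower-free family no element lies in `θ_{h-1}` sets of size `h ≥ 2`.
[cite: ImpagliazzoPaturiZaneJCSS2001, §2 (proof of Lemma 2)] -/
theorem card_filter_le_of_terminal {θ : ℕ → ℕ} {F : Finset (Finset α)}
    (hnone : ∀ b, ¬ Qual θ F b) {h : ℕ} (h2 : 2 ≤ h) (x : α) :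
    (F.filter fun s => s.card = h ∧ x ∈ s).card ≤ θ (h - 1) - 1 := by
  by_contra hcon
  exact hnone _ (qual_unitBranch (θ := θ) (F := F) (x := x) h2 (by omega))

/-- Sets of size one through `x` are just `{x}`. [folklore] -/
theorem filter_card_eq_one_subset (F : Finset (Finset α)) (x : α) :
    (F.filter fun s => s.card = 1 ∧ x ∈ s) ⊆ {{x}} := by
  intro s hs
  simp only [mem_filter] at hs
  obtain ⟨y, rfl⟩ := card_eq_one.1 hs.2.1
  simp only [mem_singleton] at hs ⊢
  rw [hs.2.2]

/-- (‡) If the selected sunflower `b` (petal size `i ≥ 2`) is first in the loop order, no element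
lies in `θ_{i-1}` of its petals.
[cite: ImpagliazzoPaturiZaneJCSS2001, §2 (proof of Lemma 3, sunflower with θ_{i-1} petals)] -/
theorem card_petals_filter_le {θ : ℕ → ℕ} {F : Finset (Finset α)} {b : Branch α}
    (hb : Qual θ F b) (hmin : ∀ b', Qual θ F b' → b.LexLE b') (h2 : 2 ≤ b.i) (x : α) :
    (b.petals.filter fun p => x ∈ p).card ≤ θ (b.i - 1) - 1 := by
  obtain ⟨hWF, hH, hi, hθ, hW⟩ := hb
  by_cases hx : x ∈ b.H
  · have : (b.petals.filter fun p => x ∈ p) = ∅ := by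
      apply filter_eq_empty_iff.2
      intro p hp
      simp only [Branch.petals, mem_image] at hp
      obtain ⟨s, -, rfl⟩ := hp
      simp [hx]
    rw [this, card_empty]; exact Nat.zero_le _
  · have hle : (b.petals.filter fun p => x ∈ p).card ≤ (b.W.filter fun s => x ∈ s).card := by
      rw [Branch.petals, filter_image]
      refine card_image_le.trans (card_le_card ?_)
      intro s hs
      simp only [mem_filter, mem_sdiff] at hs ⊢
      exact ⟨hs.1, hs.2.1⟩
    refine hle.trans ?_
    by_contra hcon
    rw [not_le] at hcon
    have hq : Qual θ F ⟨insert x b.H, b.i - 1, b.W.filter fun s => x ∈ s⟩ := by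
      refine ⟨?_, ?_, ?_, ?_, ?_⟩
      · exact (filter_subset _ _).trans hWF
      · exact insert_nonempty x _
      · show 1 ≤ b.i - 1
        omega
      · show θ (b.i - 1) ≤ (b.W.filter fun s => x ∈ s).card
        omega
      · intro s hs
        simp only [mem_filter] at hs
        obtain ⟨hHs, hcard⟩ := hW s hs.1
        refine ⟨insert_subset hs.2 hHs, ?_⟩
        show s.card = (insert x b.H).card + (b.i - 1)
        rw [card_insert_of_notMem hx, hcard]
        omega
    rcases hmin _ hq with hlt | ⟨-, hle'⟩
    · simp only [Branch.size, card_insert_of_notMem hx] at hlt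
      omega
    · change b.i ≤ b.i - 1 at hle'
      omega

/-! ### The recursion tree of `Reduce`, with history -/

/-- A node of the recursion tree of `Reduce` together with the history of its path: the current
antichain `cur`, the set `add` of all hearts and petals added along the path, and the list `ps`
of the petal sizes of the petal steps taken.
[cite: ImpagliazzoPaturiZaneJCSS2001, §2 (proof of Theorem 1)] -/
structure State (α : Type*) where
  /-- the family at the node (after `Θ`) -/
  cur : Finset (Finset α)
  /-- all sets added along the path from the root -/
  add : Finset (Finset α)
  /-- petal sizes of the petal branchings along the path -/
  ps : List ℕ

/-- Add the new sets `N`, apply `Θ`, record the petal steps `ps`.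
[cite: ImpagliazzoPaturiZaneJCSS2001, §2 (line 5 of Reduce)] -/
def State.child (σ : State α) (N : Finset (Finset α)) (ps : List ℕ) : State α :=
  ⟨minimals (σ.cur ∪ N), σ.add ∪ N, ps⟩

/-- The heart child `Θ(S ∪ {H})`.
[cite: ImpagliazzoPaturiZaneJCSS2001, §2 (line 5 of Reduce)] -/
def State.heartChild (σ : State α) (b : Branch α) : State α := σ.child {b.H} σ.ps

/-- The petal child `Θ(S ∪ {S₁ ∖ H, …, S_c ∖ H})`.
[cite: ImpagliazzoPaturiZaneJCSS2001, §2 (line 5 of Reduce)] -/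
def State.petalChild (σ : State α) (b : Branch α) : State α := σ.child b.petals (b.i :: σ.ps)

/-- The leaves of the recursion tree of `Reduce` below the node `σ` at tree position `p` (the
path from the root, most recent branching first: `false` = heart child, `true` = petal child),
explored with `fuel` levels (with enough fuel every leaf is sunflower-free, `run_terminal`). The
selection rule `step` may depend on the position `p` as well as on the family: an implementation
of `Reduce` selects the first qualifying sunflower it finds in *its* representation of the family
(a list, whose order depends on the history of the node), and any such position-dependent rule
that is valid at every node (`IsValidStep`) is covered.
[cite: ImpagliazzoPaturiZaneJCSS2001, §2 (Reduce)] -/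
def run (step : List Bool → Finset (Finset α) → Option (Branch α)) :
    ℕ → List Bool → State α → List (State α)
  | 0, _, σ => [σ]
  | f + 1, p, σ =>
    match step p σ.cur with
    | none => [σ]
    | some b =>
      run step f (false :: p) (σ.heartChild b) ++ run step f (true :: p) (σ.petalChild b)

/-- The root `Θ(S)` with empty history.
[cite: ImpagliazzoPaturiZaneJCSS2001, §2 (line 1 of Reduce)] -/
def root (S : Finset (Finset α)) : State α := ⟨minimals S, ∅, []⟩

/-- `run` with a `none` step. [folklore] -/
theorem run_succ_of_none {step : List Bool → Finset (Finset α) → Option (Branch α)} {f : ℕ}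
    {p : List Bool} {σ : State α} (h : step p σ.cur = none) : run step (f + 1) p σ = [σ] := by
  simp [run, h]

/-- `run` with a branching step. [folklore] -/
theorem run_succ_of_some {step : List Bool → Finset (Finset α) → Option (Branch α)} {f : ℕ}
    {p : List Bool} {σ : State α} {b : Branch α} (h : step p σ.cur = some b) :
    run step (f + 1) p σ =
      run step f (false :: p) (σ.heartChild b) ++ run step f (true :: p) (σ.petalChild b) := by
  simp [run, h]

/-- Every node is a leaf of its own tree or splits into the two subtrees: induction principle for
properties of leaves. [folklore] -/
theorem forall_mem_run {step : List Bool → Finset (Finset α) → Option (Branch α)}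
    {P : State α → Prop}
    (hP : ∀ p σ b, P σ → step p σ.cur = some b → P (σ.heartChild b) ∧ P (σ.petalChild b)) :
    ∀ (fuel : ℕ) (p : List Bool) (σ : State α), P σ → ∀ τ ∈ run step fuel p σ, P τ := by
  intro fuel
  induction fuel with
  | zero => intro p σ hσ τ hτ; simp only [run, List.mem_singleton] at hτ; exact hτ ▸ hσ
  | succ f ih =>
    intro p σ hσ τ hτ
    cases h : step p σ.cur with
    | none => rw [run_succ_of_none h, List.mem_singleton] at hτ; exact hτ ▸ hσ
    | some b =>
      rw [run_succ_of_some h, List.mem_append] at hτ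
      obtain ⟨h1, h2⟩ := hP p σ b hσ h
      rcases hτ with hτ | hτ
      · exact ih _ _ h1 τ hτ
      · exact ih _ _ h2 τ hτ

/-! ### Lemma 1: the leaves have the same covers -/

/-- One branching step preserves covers: `σ(S) = σ(S ∪ {H}) ∪ σ(S ∪ {petals})`.
[cite: ImpagliazzoPaturiZaneJCSS2001, §2 Lemma 1] -/
theorem covers_iff_children {θ : ℕ → ℕ} {σ : State α} {b : Branch α} (hb : Qual θ σ.cur b)
    (X : Finset α) :
    Covers X σ.cur ↔ Covers X (σ.heartChild b).cur ∨ Covers X (σ.petalChild b).cur := by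
  simp only [State.heartChild, State.petalChild, State.child, covers_minimals_iff, covers_union]
  constructor
  · intro hX
    by_cases hH : (b.H ∩ X).Nonempty
    · exact Or.inl ⟨hX, fun s hs => by rw [mem_singleton] at hs; exact hs ▸ hH⟩
    · refine Or.inr ⟨hX, fun p hp => ?_⟩
      simp only [Branch.petals, mem_image] at hp
      obtain ⟨s, hs, rfl⟩ := hp
      obtain ⟨a, ha⟩ := hX s (hb.1 hs)
      rw [mem_inter] at ha
      refine ⟨a, mem_inter.2 ⟨mem_sdiff.2 ⟨ha.1, fun haH => hH ⟨a, mem_inter.2 ⟨haH, ha.2⟩⟩⟩,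
        ha.2⟩⟩
  · rintro (h | h) <;> exact h.1

/-- **Lemma 1.** `X` covers the family at a node iff it covers the family at some leaf below it.
[cite: ImpagliazzoPaturiZaneJCSS2001, §2 Lemma 1] -/
theorem covers_iff_exists_leaf {θ : ℕ → ℕ}
    {step : List Bool → Finset (Finset α) → Option (Branch α)}
    (hstep : ∀ p, IsValidStep θ (step p)) (X : Finset α) :
    ∀ (fuel : ℕ) (p : List Bool) (σ : State α),
      Covers X σ.cur ↔ ∃ τ ∈ run step fuel p σ, Covers X τ.cur := by
  intro fuel
  induction fuel with
  | zero => intro p σ; simp [run]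
  | succ f ih =>
    intro p σ
    cases h : step p σ.cur with
    | none => rw [run_succ_of_none h]; simp
    | some b =>
      rw [run_succ_of_some h, covers_iff_children ((hstep p σ.cur).2 b h).1 X,
        ih (false :: p), ih (true :: p)]
      simp only [List.mem_append, or_and_right, exists_or]

/-! ### The parameters `θ_i`, `A_i` -/

/-- `par M i = (θ_i, A_i)`: the sunflower thresholds `θ_i` and the coefficients `A_i` of the
bound `A_i · n` on the number of added sets of size `≤ i` along a path, defined together by
`θ₀ = 1`, `A₀ = 0`, `θ_{i+1} = M · (2θ_i - 1)(1 + A_i)`, `A_{i+1} = A_i + (2θ_i - 1)(1 + A_i)`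
(so `θ₁ = M`, and `M` plays the role of the large integer `α` of the printed proof; the printed
`β_i` correspond to `A_i` up to the bookkeeping of Lemma 5).
[cite: ImpagliazzoPaturiZaneJCSS2001, §2 (proof of Theorem 1, choice of θ_i, β_i)] -/
def par (M : ℕ) : ℕ → ℕ × ℕ
  | 0 => (1, 0)
  | i + 1 => (M * ((2 * (par M i).1 - 1) * (1 + (par M i).2)),
      (par M i).2 + (2 * (par M i).1 - 1) * (1 + (par M i).2))

/-- The threshold `θ_i` (branch on sunflowers with at least `θ_i` petals of size `i`).
[cite: ImpagliazzoPaturiZaneJCSS2001, §2 (θ_i)] -/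
def theta (M i : ℕ) : ℕ := (par M i).1

/-- The coefficient `A_i`: along a path at most `A_i · n` sets of size `≤ i` are added
(`card_add_filter_le`). [cite: ImpagliazzoPaturiZaneJCSS2001, §2 Lemma 5 (β_i)] -/
def abnd (M i : ℕ) : ℕ := (par M i).2

/-- `incr M i = (2θ_i - 1)(1 + A_i)`: at most `incr M i · n` sets of size `i + 1` are added along
a path. [cite: ImpagliazzoPaturiZaneJCSS2001, §2 (proof of Lemma 5)] -/
def incr (M i : ℕ) : ℕ := (2 * theta M i - 1) * (1 + abnd M i)

/-- `jb M i = 2θ_{i-1} - 1`, the bound of the invariant `J_i`: once a set of size `i` has been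
added, no element lies in more than `2θ_{i-1} - 1` current sets of size `i`.
[cite: ImpagliazzoPaturiZaneJCSS2001, §2 Lemma 3 (J_i)] -/
def jb (M i : ℕ) : ℕ := 2 * theta M (i - 1) - 1

/-- `θ₀ = 1`. [folklore] -/
theorem theta_zero (M : ℕ) : theta M 0 = 1 := rfl

/-- `A₀ = 0`. [folklore] -/
theorem abnd_zero (M : ℕ) : abnd M 0 = 0 := rfl

/-- `θ_{i+1} = M · incr_i`. [folklore] -/
theorem theta_succ (M i : ℕ) : theta M (i + 1) = M * incr M i := rfl

/-- `A_{i+1} = A_i + incr_i`. [folklore] -/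
theorem abnd_succ (M i : ℕ) : abnd M (i + 1) = abnd M i + incr M i := rfl

/-- `jb (i+1) = 2θ_i - 1`. [folklore] -/
theorem jb_succ (M i : ℕ) : jb M (i + 1) = 2 * theta M i - 1 := rfl

/-- `incr_i = jb (i+1) · (1 + A_i)`. [folklore] -/
theorem incr_eq (M i : ℕ) : incr M i = jb M (i + 1) * (1 + abnd M i) := rfl

/-- `θ_i ≥ 1` when `M ≥ 1`. [folklore] -/
theorem one_le_theta {M : ℕ} (hM : 1 ≤ M) : ∀ i, 1 ≤ theta M i
  | 0 => le_rfl
  | i + 1 => by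
    have ih := one_le_theta hM i
    rw [theta_succ, incr]
    exact Nat.one_le_iff_ne_zero.2
      (Nat.mul_ne_zero (by omega) (Nat.mul_ne_zero (by omega) (by omega)))

/-- `incr_i ≥ 1` when `M ≥ 1`. [folklore] -/
theorem one_le_incr {M : ℕ} (hM : 1 ≤ M) (i : ℕ) : 1 ≤ incr M i := by
  have := one_le_theta hM i
  rw [incr]
  exact Nat.one_le_iff_ne_zero.2 (Nat.mul_ne_zero (by omega) (by omega))

/-- `jb i ≥ 1` when `M ≥ 1`. [folklore] -/
theorem one_le_jb {M : ℕ} (hM : 1 ≤ M) (i : ℕ) : 1 ≤ jb M i := by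
  have := one_le_theta hM (i - 1)
  rw [jb]
  omega

/-! ### Lemmas 3–6: the invariant of the recursion -/

/-- The invariant of a node `σ` of the recursion tree of `Reduce(Θ(S₀))` with its history:
`cur` is an antichain of members of `S₀` and added sets, below every such set (a restriction),
consisting of subsets of members of `S₀`; added sets are nonempty; **J_i** (Lemma 3): once an
`i`-set has been added no element lies in more than `2θ_{i-1} - 1` current `i`-sets; (Lemma 4,
summed) the added `i`-sets no longer current number at most `2θ_{i-1} - 1` times the added sets
of smaller size; (Lemma 6, per size) `θ_i` times the number of petal steps of petal size `i` is
at most the number of added `i`-sets; petal sizes lie in `[1, k)`.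
[cite: ImpagliazzoPaturiZaneJCSS2001, §2 Lemmas 3–6] -/
structure Inv (k M : ℕ) (S₀ : Finset (Finset α)) (σ : State α) : Prop where
  /-- `cur` is an antichain -/
  antichain : IsAntichain (· ⊆ ·) (σ.cur : Set (Finset α))
  /-- current sets are original or added -/
  cur_subset : σ.cur ⊆ S₀ ∪ σ.add
  /-- `cur` is a restriction of `S₀ ∪ add` -/
  exists_subset : ∀ s ∈ S₀ ∪ σ.add, ∃ c ∈ σ.cur, c ⊆ s
  /-- every set met is a subset of an original set -/
  subset_orig : ∀ s ∈ σ.cur ∪ σ.add, ∃ t ∈ S₀, s ⊆ t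
  /-- added sets are nonempty -/
  add_nonempty : ∀ e ∈ σ.add, e.Nonempty
  /-- the invariant `J_i` -/
  deg_le : ∀ i, (∃ e ∈ σ.add, e.card = i) → ∀ x : α,
    (σ.cur.filter fun s => s.card = i ∧ x ∈ s).card ≤ jb M i
  /-- eliminated added `i`-sets -/
  elim_le : ∀ i, (σ.add.filter fun e => e.card = i ∧ e ∉ σ.cur).card ≤
    jb M i * (σ.add.filter fun e => e.card < i).card
  /-- petal-step budget -/
  theta_mul_count_le : ∀ i, theta M i * σ.ps.count i ≤ (σ.add.filter fun e => e.card = i).card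
  /-- petal sizes -/
  ps_bound : ∀ i ∈ σ.ps, 1 ≤ i ∧ i < k

section Inv

variable {k M : ℕ} {S₀ : Finset (Finset α)} {σ : State α}

/-- The root satisfies the invariant. [folklore] -/
theorem Inv.root (k M : ℕ) (S₀ : Finset (Finset α)) : Inv k M S₀ (root S₀) where
  antichain := minimals_antichain _
  cur_subset := by
    show minimals S₀ ⊆ S₀ ∪ ∅
    rw [union_empty]; exact minimals_subset _
  exists_subset := by
    show ∀ s ∈ S₀ ∪ ∅, ∃ c ∈ minimals S₀, c ⊆ s
    intro s hs; rw [union_empty] at hs; exact exists_mem_minimals_subset hs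
  subset_orig := by
    show ∀ s ∈ minimals S₀ ∪ ∅, ∃ t ∈ S₀, s ⊆ t
    intro s hs; rw [union_empty] at hs; exact ⟨s, minimals_subset _ hs, Subset.refl _⟩
  add_nonempty := by show ∀ e ∈ (∅ : Finset (Finset α)), e.Nonempty; simp
  deg_le := by
    intro i hi
    obtain ⟨e, he, -⟩ := hi
    exact absurd he (by show e ∉ (∅ : Finset (Finset α)); simp)
  elim_le := by intro i; show (filter _ ∅).card ≤ _; simp
  theta_mul_count_le := by intro i; show theta M i * List.count i [] ≤ _; simp
  ps_bound := by intro i hi; exact absurd hi (by show i ∉ ([] : List ℕ); simp)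

/-- Fresh sets are not already added (nor original). [folklore] -/
theorem Inv.disjoint_add (hσ : Inv k M S₀ σ) {N : Finset (Finset α)}
    (hfresh : ∀ n ∈ N, ∀ c ∈ σ.cur, ¬ c ⊆ n) : Disjoint σ.add N := by
  rw [Finset.disjoint_right]
  intro n hn hnA
  obtain ⟨c, hc, hcn⟩ := hσ.exists_subset n (mem_union_right _ hnA)
  exact hfresh n hn c hc hcn

/-- **Lemmas 3 and 4, one step.** Adding a fresh antichain `N` of nonempty `i₀`-subsets of current
sets preserves the invariant, provided the new `i₀`-degrees obey `J_{i₀}` and the petal budget is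
maintained. [cite: ImpagliazzoPaturiZaneJCSS2001, §2 Lemmas 3–4] -/
theorem Inv.child (hσ : Inv k M S₀ σ) {N : Finset (Finset α)} {i₀ : ℕ} {ps' : List ℕ}
    (hfresh : ∀ n ∈ N, ∀ c ∈ σ.cur, ¬ c ⊆ n)
    (hanti : ∀ n ∈ N, ∀ m ∈ N, m ⊆ n → m = n)
    (hne : ∀ n ∈ N, n.Nonempty)
    (hsub : ∀ n ∈ N, ∃ c ∈ σ.cur, n ⊆ c)
    (hcard : ∀ n ∈ N, n.card = i₀)
    (hdeg : ∀ x, (σ.cur.filter fun s => s.card = i₀ ∧ x ∈ s).card +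
      (N.filter fun n => x ∈ n).card ≤ jb M i₀)
    (hps : ∀ i, theta M i * ps'.count i ≤ ((σ.add ∪ N).filter fun e => e.card = i).card)
    (hps' : ∀ i ∈ ps', 1 ≤ i ∧ i < k) :
    Inv k M S₀ (σ.child N ps') where
  antichain := minimals_antichain _
  cur_subset := by
    show minimals (σ.cur ∪ N) ⊆ S₀ ∪ (σ.add ∪ N)
    intro s hs
    rcases mem_union.1 (minimals_subset _ hs) with h | h
    · rcases mem_union.1 (hσ.cur_subset h) with h' | h'
      · exact mem_union_left _ h'
      · exact mem_union_right _ (mem_union_left _ h')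
    · exact mem_union_right _ (mem_union_right _ h)
  exists_subset := by
    show ∀ s ∈ S₀ ∪ (σ.add ∪ N), ∃ c ∈ minimals (σ.cur ∪ N), c ⊆ s
    intro s hs
    have : ∃ c ∈ σ.cur ∪ N, c ⊆ s := by
      rcases mem_union.1 hs with h | h
      · obtain ⟨c, hc, hcs⟩ := hσ.exists_subset s (mem_union_left _ h)
        exact ⟨c, mem_union_left _ hc, hcs⟩
      · rcases mem_union.1 h with h | h
        · obtain ⟨c, hc, hcs⟩ := hσ.exists_subset s (mem_union_right _ h)
          exact ⟨c, mem_union_left _ hc, hcs⟩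
        · exact ⟨s, mem_union_right _ h, Subset.refl _⟩
    obtain ⟨c, hc, hcs⟩ := this
    obtain ⟨c', hc', hc'c⟩ := exists_mem_minimals_subset hc
    exact ⟨c', hc', hc'c.trans hcs⟩
  subset_orig := by
    show ∀ s ∈ minimals (σ.cur ∪ N) ∪ (σ.add ∪ N), ∃ t ∈ S₀, s ⊆ t
    have hN : ∀ n ∈ N, ∃ t ∈ S₀, n ⊆ t := fun n hn => by
      obtain ⟨c, hc, hnc⟩ := hsub n hn
      obtain ⟨t, ht, hct⟩ := hσ.subset_orig c (mem_union_left _ hc)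
      exact ⟨t, ht, hnc.trans hct⟩
    intro s hs
    rcases mem_union.1 hs with h | h
    · rcases mem_union.1 (minimals_subset _ h) with h | h
      · exact hσ.subset_orig s (mem_union_left _ h)
      · exact hN s h
    · rcases mem_union.1 h with h | h
      · exact hσ.subset_orig s (mem_union_right _ h)
      · exact hN s h
  add_nonempty := by
    show ∀ e ∈ σ.add ∪ N, e.Nonempty
    intro e he
    rcases mem_union.1 he with h | h
    · exact hσ.add_nonempty e h
    · exact hne e h
  deg_le := by
    show ∀ i, (∃ e ∈ σ.add ∪ N, e.card = i) → ∀ x,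
      ((minimals (σ.cur ∪ N)).filter fun s => s.card = i ∧ x ∈ s).card ≤ jb M i
    intro i hi x
    by_cases hii : i = i₀
    · subst hii
      refine le_trans (card_le_card ?_) ((card_union_le _ _).trans (hdeg x))
      intro s hs
      simp only [mem_filter, mem_union] at hs ⊢
      rcases mem_union.1 (minimals_subset _ hs.1) with h | h
      · exact Or.inl ⟨h, hs.2⟩
      · exact Or.inr ⟨h, hs.2.2⟩
    · have hi' : ∃ e ∈ σ.add, e.card = i := by
        obtain ⟨e, he, hei⟩ := hi
        rcases mem_union.1 he with h | h
        · exact ⟨e, h, hei⟩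
        · exact absurd (hei.symm.trans (hcard e h)) hii
      refine le_trans (card_le_card ?_) (hσ.deg_le i hi' x)
      intro s hs
      simp only [mem_filter] at hs ⊢
      rcases mem_union.1 (minimals_subset _ hs.1) with h | h
      · exact ⟨h, hs.2⟩
      · exact absurd (hs.2.1.symm.trans (hcard s h)) hii
  elim_le := by
    show ∀ i,
      ((σ.add ∪ N).filter fun e => e.card = i ∧ e ∉ minimals (σ.cur ∪ N)).card ≤
      jb M i * ((σ.add ∪ N).filter fun e => e.card < i).card
    intro i
    have hdisj : Disjoint σ.add N := hσ.disjoint_add hfresh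
    set E := σ.add.filter fun e => e.card = i ∧ e ∉ σ.cur with hE
    set B := (N.filter fun n => n.card < i).biUnion fun n =>
      σ.cur.filter fun e => e.card = i ∧ e ∈ σ.add ∧ n ⊆ e with hB
    have hsubEB : ((σ.add ∪ N).filter fun e => e.card = i ∧ e ∉ minimals (σ.cur ∪ N)) ⊆
        E ∪ B := by
      intro e he
      simp only [mem_filter, mem_union] at he
      obtain ⟨he, hei, hemin⟩ := he
      have heN : e ∉ N := fun h => hemin (mem_minimals_union_of_fresh h
        (fun c hc => hfresh e h c hc) (fun m hm hme => hanti e h m hm hme))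
      have heA : e ∈ σ.add := he.resolve_right heN
      by_cases hec : e ∈ σ.cur
      · obtain ⟨n, hn, hne⟩ := exists_ssubset_of_not_mem_minimals hσ.antichain hec hemin
        refine mem_union_right _ (mem_biUnion.2 ⟨n, mem_filter.2 ⟨hn, ?_⟩,
          mem_filter.2 ⟨hec, hei, heA, hne.1⟩⟩)
        exact hei ▸ card_lt_card hne
      · exact mem_union_left _ (mem_filter.2 ⟨heA, hei, hec⟩)
    have hBcard : B.card ≤ (N.filter fun n => n.card < i).card * jb M i := by
      refine card_biUnion_le.trans ?_
      refine (sum_le_card_nsmul _ _ (jb M i) ?_).trans (by simp)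
      intro n hn
      simp only [mem_filter] at hn
      obtain ⟨x, hx⟩ := hne n hn.1
      rcases (σ.cur.filter fun e => e.card = i ∧ e ∈ σ.add ∧ n ⊆ e).eq_empty_or_nonempty
        with hempty | ⟨e, he⟩
      · rw [hempty, card_empty]; exact Nat.zero_le _
      · simp only [mem_filter] at he
        have hi' : ∃ e ∈ σ.add, e.card = i := ⟨e, he.2.2.1, he.2.1⟩
        refine le_trans (card_le_card ?_) (hσ.deg_le i hi' x)
        intro e' he'
        simp only [mem_filter] at he' ⊢
        exact ⟨he'.1, he'.2.1, he'.2.2.2 hx⟩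
    have hEcard : E.card ≤ jb M i * (σ.add.filter fun e => e.card < i).card := hσ.elim_le i
    have hsplit : ((σ.add ∪ N).filter fun e => e.card < i).card =
        (σ.add.filter fun e => e.card < i).card + (N.filter fun n => n.card < i).card := by
      rw [filter_union, card_union_of_disjoint (disjoint_filter_filter hdisj)]
    calc _ ≤ (E ∪ B).card := card_le_card hsubEB
      _ ≤ E.card + B.card := card_union_le _ _
      _ ≤ jb M i * (σ.add.filter fun e => e.card < i).card +
          (N.filter fun n => n.card < i).card * jb M i := add_le_add hEcard hBcard
      _ = _ := by rw [hsplit]; ring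
  theta_mul_count_le := hps
  ps_bound := hps'

/-- In a family of one-element sets, the sets through `x` are just `{x}`. [folklore] -/
theorem filter_mem_subset_of_card_eq_one {G : Finset (Finset α)} (hG : ∀ s ∈ G, s.card = 1)
    (x : α) : (G.filter fun s => x ∈ s) ⊆ {{x}} := by
  intro s hs
  simp only [mem_filter] at hs
  obtain ⟨y, rfl⟩ := card_eq_one.1 (hG s hs.1)
  simp only [mem_singleton] at hs ⊢
  rw [hs.2]

omit [DecidableEq α] in
/-- The heart of a qualifying sunflower of an antichain is fresh: no current set lies below it.
[cite: ImpagliazzoPaturiZaneJCSS2001, §2 ("no proper superset of S would ever be present")] -/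
theorem fresh_heart {θ : ℕ → ℕ} {F : Finset (Finset α)}
    (hF : IsAntichain (· ⊆ ·) (F : Set (Finset α))) {b : Branch α} (hb : Qual θ F b)
    (hθ : 1 ≤ θ b.i) : ∀ c ∈ F, ¬ c ⊆ b.H := by
  obtain ⟨hWF, -, hi, hθ', hW⟩ := hb
  obtain ⟨s₀, hs₀⟩ : b.W.Nonempty := card_pos.1 (lt_of_lt_of_le hθ hθ')
  intro c hc hcH
  obtain ⟨hHs, hcard⟩ := hW s₀ hs₀
  have := hF.eq (mem_coe.2 hc) (mem_coe.2 (hWF hs₀)) (hcH.trans hHs)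
  subst this
  have := card_le_card hcH
  omega

/-- The petals of a qualifying sunflower of an antichain are fresh.
[cite: ImpagliazzoPaturiZaneJCSS2001, §2 ("no proper superset of S would ever be present")] -/
theorem fresh_petals {θ : ℕ → ℕ} {F : Finset (Finset α)}
    (hF : IsAntichain (· ⊆ ·) (F : Set (Finset α))) {b : Branch α} (hb : Qual θ F b) :
    ∀ p ∈ b.petals, ∀ c ∈ F, ¬ c ⊆ p := by
  obtain ⟨hWF, ⟨h₀, hh₀⟩, -, -, hW⟩ := hb
  intro p hp c hc hcp
  simp only [Branch.petals, mem_image] at hp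
  obtain ⟨s, hs, rfl⟩ := hp
  have hcs : c = s := hF.eq (mem_coe.2 hc) (mem_coe.2 (hWF hs)) (hcp.trans sdiff_subset)
  subst hcs
  exact (mem_sdiff.1 (hcp ((hW c hs).1 hh₀))).2 hh₀

/-- **The heart child satisfies the invariant** (Lemma 3, heart case).
[cite: ImpagliazzoPaturiZaneJCSS2001, §2 Lemma 3 ("If the heart is added …")] -/
theorem Inv.heartChild (hσ : Inv k M S₀ σ) (hM : 1 ≤ M) {b : Branch α}
    (hb : Qual (theta M) σ.cur b) (hmin : ∀ b', Qual (theta M) σ.cur b' → b.LexLE b') :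
    Inv k M S₀ (σ.heartChild b) := by
  have hfresh : ∀ c ∈ σ.cur, ¬ c ⊆ b.H := fresh_heart hσ.antichain hb (one_le_theta hM _)
  obtain ⟨hWF, hH, hi, hθ, hW⟩ := hb
  obtain ⟨s₀, hs₀⟩ : b.W.Nonempty := card_pos.1 (lt_of_lt_of_le (one_le_theta hM _) hθ)
  refine hσ.child (N := {b.H}) (i₀ := b.H.card) (ps' := σ.ps) ?_ ?_ ?_ ?_ ?_ ?_ ?_ hσ.ps_bound
  · intro n hn; rw [mem_singleton] at hn; rw [hn]; exact hfresh
  · intro n hn m hm _; rw [mem_singleton] at hn hm; rw [hn, hm]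
  · intro n hn; rw [mem_singleton] at hn; rw [hn]; exact hH
  · intro n hn; rw [mem_singleton] at hn; rw [hn]; exact ⟨s₀, hWF hs₀, (hW s₀ hs₀).1⟩
  · intro n hn; rw [mem_singleton] at hn; rw [hn]
  · intro x
    have hsec : (({b.H} : Finset (Finset α)).filter fun n => x ∈ n).card ≤ 1 :=
      (card_le_card (filter_subset _ _)).trans (by simp)
    rcases Nat.lt_or_ge b.H.card 2 with hlt | h2
    · have hH1 : b.H.card = 1 := by have := hH.card_pos; omega
      obtain ⟨y, hy⟩ := card_eq_one.1 hH1
      have hjb : jb M b.H.card = 1 := by rw [hH1]; rfl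
      rw [hjb]
      by_cases hxy : x = y
      · subst hxy
        have h0 : (σ.cur.filter fun s => s.card = b.H.card ∧ x ∈ s) = ∅ := by
          apply filter_eq_empty_iff.2
          rintro s hs ⟨hs1, hxs⟩
          rw [hH1] at hs1
          obtain ⟨z, rfl⟩ := card_eq_one.1 hs1
          rw [mem_singleton] at hxs; subst hxs
          exact hfresh _ hs (by rw [hy])
        rw [h0, card_empty, zero_add]; exact hsec
      · have h0 : (({b.H} : Finset (Finset α)).filter fun n => x ∈ n) = ∅ := by
          apply filter_eq_empty_iff.2
          intro n hn hxn
          rw [mem_singleton] at hn; rw [hn, hy, mem_singleton] at hxn; exact hxy hxn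
        rw [h0, card_empty, add_zero, hH1]
        exact (card_le_card (filter_card_eq_one_subset σ.cur x)).trans (by simp)
    · have hlt : b.H.card < b.size := by unfold Branch.size; omega
      have h1 := card_filter_le_of_lexMin hmin h2 hlt x
      have hθ1 := one_le_theta hM (b.H.card - 1)
      have hjb : jb M b.H.card = 2 * theta M (b.H.card - 1) - 1 := rfl
      omega
  · intro i
    refine (hσ.theta_mul_count_le i).trans (card_le_card ?_)
    exact filter_subset_filter _ subset_union_left

/-- Membership in the petals. [folklore] -/
theorem Branch.mem_petals {b : Branch α} {p : Finset α} :
    p ∈ b.petals ↔ ∃ s ∈ b.W, s \ b.H = p := by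
  simp [Branch.petals]

/-- The petal map `S ↦ S ∖ H` is injective on the sunflower. [folklore] -/
theorem Branch.sdiff_injOn {θ : ℕ → ℕ} {F : Finset (Finset α)} {b : Branch α}
    (hb : Qual θ F b) : Set.InjOn (fun s => s \ b.H) (b.W : Set (Finset α)) := by
  intro s hs t ht hst
  have hs' := (hb.2.2.2.2 s (mem_coe.1 hs)).1
  have ht' := (hb.2.2.2.2 t (mem_coe.1 ht)).1
  simp only at hst
  rw [← union_sdiff_of_subset hs', ← union_sdiff_of_subset ht', hst]

/-- The sunflower has as many petals as sets. [folklore] -/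
theorem Branch.card_petals {θ : ℕ → ℕ} {F : Finset (Finset α)} {b : Branch α}
    (hb : Qual θ F b) : b.petals.card = b.W.card := by
  rw [Branch.petals, card_image_of_injOn (Branch.sdiff_injOn hb)]

/-- Petals have size `i`. [folklore] -/
theorem Branch.card_of_mem_petals {θ : ℕ → ℕ} {F : Finset (Finset α)} {b : Branch α}
    (hb : Qual θ F b) {p : Finset α} (hp : p ∈ b.petals) : p.card = b.i := by
  obtain ⟨s, hs, rfl⟩ := Branch.mem_petals.1 hp
  obtain ⟨hHs, hcard⟩ := hb.2.2.2.2 s hs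
  rw [card_sdiff_of_subset hHs, hcard]
  omega

/-- **The petal child satisfies the invariant** (Lemma 3, petal case, and Lemma 6).
[cite: ImpagliazzoPaturiZaneJCSS2001, §2 Lemma 3 ("If the petals are added …"), Lemma 6] -/
theorem Inv.petalChild (hσ : Inv k M S₀ σ) (hS : ∀ s ∈ S₀, s.card ≤ k) (hM : 1 ≤ M)
    {b : Branch α} (hb : Qual (theta M) σ.cur b)
    (hmin : ∀ b', Qual (theta M) σ.cur b' → b.LexLE b') :
    Inv k M S₀ (σ.petalChild b) := by
  have hfresh : ∀ p ∈ b.petals, ∀ c ∈ σ.cur, ¬ c ⊆ p := fresh_petals hσ.antichain hb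
  obtain ⟨hWF, hH, hi, hθ, hW⟩ := id hb
  obtain ⟨s₀, hs₀⟩ : b.W.Nonempty := card_pos.1 (lt_of_lt_of_le (one_le_theta hM _) hθ)
  obtain ⟨h₀, hh₀⟩ := hH
  have hik : b.i < k := by
    obtain ⟨t, ht, hst⟩ := hσ.subset_orig s₀ (mem_union_left _ (hWF hs₀))
    have h1 := card_le_card hst
    have h2 := hS t ht
    have h3 := (hW s₀ hs₀).2
    have h4 : 1 ≤ b.H.card := card_pos.2 ⟨h₀, hh₀⟩
    omega
  have hdisj : Disjoint σ.add b.petals := hσ.disjoint_add hfresh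
  refine hσ.child (N := b.petals) (i₀ := b.i) (ps' := b.i :: σ.ps) hfresh ?_ ?_ ?_
    (fun p hp => Branch.card_of_mem_petals hb hp) ?_ ?_ ?_
  · intro p hp q hq hqp
    obtain ⟨s, hs, rfl⟩ := Branch.mem_petals.1 hp
    obtain ⟨t, ht, rfl⟩ := Branch.mem_petals.1 hq
    have hts : t ⊆ s := by
      rw [← union_sdiff_of_subset (hW t ht).1, ← union_sdiff_of_subset (hW s hs).1]
      exact union_subset_union (Subset.refl _) hqp
    rw [hσ.antichain.eq (mem_coe.2 (hWF ht)) (mem_coe.2 (hWF hs)) hts]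
  · intro p hp
    exact card_pos.1 (lt_of_lt_of_le hi (Branch.card_of_mem_petals hb hp).ge)
  · intro p hp
    obtain ⟨s, hs, rfl⟩ := Branch.mem_petals.1 hp
    exact ⟨s, hWF hs, sdiff_subset⟩
  · intro x
    rcases Nat.lt_or_ge b.i 2 with hlt | h2
    · have hi1 : b.i = 1 := by omega
      have hjb : jb M b.i = 1 := by rw [hi1]; rfl
      rw [hjb]
      have hpet1 : ∀ p ∈ b.petals, p.card = 1 := fun p hp =>
        (Branch.card_of_mem_petals hb hp).trans hi1
      have hsec : (b.petals.filter fun p => x ∈ p) ⊆ {{x}} :=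
        filter_mem_subset_of_card_eq_one hpet1 x
      by_cases hx : {x} ∈ b.petals
      · have h0 : (σ.cur.filter fun s => s.card = b.i ∧ x ∈ s) = ∅ := by
          apply filter_eq_empty_iff.2
          rintro s hs ⟨hs1, hxs⟩
          rw [hi1] at hs1
          obtain ⟨z, rfl⟩ := card_eq_one.1 hs1
          rw [mem_singleton] at hxs; subst hxs
          exact hfresh _ hx _ hs (Subset.refl _)
        rw [h0, card_empty, zero_add]
        exact (card_le_card hsec).trans (by simp)
      · have h0 : (b.petals.filter fun p => x ∈ p) = ∅ := by
          apply filter_eq_empty_iff.2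
          intro p hp hxp
          have : p = {x} := mem_singleton.1 (hsec (mem_filter.2 ⟨hp, hxp⟩))
          exact hx (this ▸ hp)
        rw [h0, card_empty, add_zero, hi1]
        exact (card_le_card (filter_card_eq_one_subset σ.cur x)).trans (by simp)
    · have hlt : b.i < b.size := by
        have h4 : 1 ≤ b.H.card := card_pos.2 ⟨h₀, hh₀⟩
        unfold Branch.size; omega
      have h1 := card_filter_le_of_lexMin hmin h2 hlt x
      have h2' := card_petals_filter_le hb hmin h2 x
      have hjb : jb M b.i = 2 * theta M (b.i - 1) - 1 := rfl
      omega
  · intro i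
    show theta M i * (b.i :: σ.ps).count i ≤
      ((σ.add ∪ b.petals).filter fun e => e.card = i).card
    rw [filter_union, card_union_of_disjoint (disjoint_filter_filter hdisj), List.count_cons]
    by_cases hbi : b.i = i
    · subst hbi
      have hpet : (b.petals.filter fun e => e.card = b.i) = b.petals :=
        filter_true_of_mem fun p hp => Branch.card_of_mem_petals hb hp
      rw [hpet, Branch.card_petals hb]
      simp only [beq_self_eq_true, ite_true, Nat.mul_succ]
      exact add_le_add (hσ.theta_mul_count_le b.i) hθ
    · have : (b.i == i) = false := beq_eq_false_iff_ne.2 hbi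
      simp only [this]
      exact (hσ.theta_mul_count_le i).trans (Nat.le_add_right _ _)
  · intro i hi'
    rcases List.mem_cons.1 hi' with h | h
    · subst h; exact ⟨hi, hik⟩
    · exact hσ.ps_bound i h

end Inv

/-! ### Lemma 5: counting added sets and petal steps along a path -/

section Bounds

variable [Fintype α] {k M : ℕ} {S₀ : Finset (Finset α)} {σ : State α}

/-- Degree counting: a family of nonempty sets in which every element lies in at most `d` sets
has at most `d · n` members. [folklore] -/
theorem card_le_mul_of_deg_le {G : Finset (Finset α)} (hG : ∀ s ∈ G, s.Nonempty) {d : ℕ}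
    (hd : ∀ x, (G.filter fun s => x ∈ s).card ≤ d) : G.card ≤ d * Fintype.card α := by
  have hsub : G ⊆ (univ : Finset α).biUnion fun x => G.filter fun s => x ∈ s := by
    intro s hs
    obtain ⟨x, hx⟩ := hG s hs
    exact mem_biUnion.2 ⟨x, mem_univ _, mem_filter.2 ⟨hs, hx⟩⟩
  calc G.card ≤ ((univ : Finset α).biUnion fun x => G.filter fun s => x ∈ s).card :=
        card_le_card hsub
    _ ≤ ∑ x, (G.filter fun s => x ∈ s).card := card_biUnion_le
    _ ≤ ∑ _x : α, d := sum_le_sum fun x _ => hd x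
    _ = d * Fintype.card α := by rw [sum_const, card_univ, smul_eq_mul, mul_comm]

/-- Added `i`-sets, `i ≥ 1`: at most `(2θ_{i-1} - 1) · (n + #added sets of size < i)` (current
ones by `J_i` and degree counting, eliminated ones by Lemma 4).
[cite: ImpagliazzoPaturiZaneJCSS2001, §2 (proof of Lemma 5)] -/
theorem Inv.card_add_filter_eq_le (hσ : Inv k M S₀ σ) {i : ℕ} (hi : 1 ≤ i) :
    (σ.add.filter fun e => e.card = i).card ≤
      jb M i * (Fintype.card α + (σ.add.filter fun e => e.card < i).card) := by
  by_cases h : ∃ e ∈ σ.add, e.card = i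
  · have hcur : (σ.cur.filter fun s => s.card = i).card ≤ jb M i * Fintype.card α := by
      refine card_le_mul_of_deg_le (fun s hs => ?_) (fun x => ?_)
      · simp only [mem_filter] at hs; exact card_pos.1 (hi.trans_eq hs.2.symm)
      · rw [filter_filter]; exact hσ.deg_le i h x
    have hsplit : (σ.add.filter fun e => e.card = i) ⊆
        (σ.cur.filter fun s => s.card = i) ∪
          (σ.add.filter fun e => e.card = i ∧ e ∉ σ.cur) := by
      intro e he
      simp only [mem_filter, mem_union] at he ⊢
      by_cases hec : e ∈ σ.cur
      · exact Or.inl ⟨hec, he.2⟩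
      · exact Or.inr ⟨he.1, he.2, hec⟩
    calc _ ≤ _ := card_le_card hsplit
      _ ≤ _ := card_union_le _ _
      _ ≤ jb M i * Fintype.card α + jb M i * (σ.add.filter fun e => e.card < i).card :=
          add_le_add hcur (hσ.elim_le i)
      _ = _ := by ring
  · have : (σ.add.filter fun e => e.card = i) = ∅ :=
      filter_eq_empty_iff.2 fun e he hei => h ⟨e, he, hei⟩
    rw [this, card_empty]; exact Nat.zero_le _

/-- **Lemma 5.** Along a path at most `A_i · n` sets of size `≤ i` are added.
[cite: ImpagliazzoPaturiZaneJCSS2001, §2 Lemma 5] -/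
theorem Inv.card_add_filter_le (hσ : Inv k M S₀ σ) :
    ∀ i, (σ.add.filter fun e => e.card ≤ i).card ≤ abnd M i * Fintype.card α
  | 0 => by
    have : (σ.add.filter fun e => e.card ≤ 0) = ∅ :=
      filter_eq_empty_iff.2 fun e he h0 => by
        have := (hσ.add_nonempty e he).card_pos; omega
    rw [this, card_empty]; exact Nat.zero_le _
  | i + 1 => by
    have ih := hσ.card_add_filter_le i
    have hsplit : (σ.add.filter fun e => e.card ≤ i + 1) ⊆
        (σ.add.filter fun e => e.card ≤ i) ∪ (σ.add.filter fun e => e.card = i + 1) := by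
      intro e he
      simp only [mem_filter, mem_union] at he ⊢
      rcases Nat.lt_or_ge e.card (i + 1) with h' | h'
      · exact Or.inl ⟨he.1, by omega⟩
      · exact Or.inr ⟨he.1, by omega⟩
    have hlt : (σ.add.filter fun e => e.card < i + 1) = (σ.add.filter fun e => e.card ≤ i) :=
      filter_congr fun e _ => Nat.lt_succ_iff
    have h2 := hσ.card_add_filter_eq_le (i := i + 1) (by omega)
    rw [hlt] at h2
    rw [abnd_succ, incr_eq]
    calc _ ≤ _ := card_le_card hsplit
      _ ≤ _ := card_union_le _ _
      _ ≤ abnd M i * Fintype.card α +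
          jb M (i + 1) * (Fintype.card α + abnd M i * Fintype.card α) := by
          refine add_le_add ih (h2.trans ?_)
          exact Nat.mul_le_mul_left _ (Nat.add_le_add_left ih _)
      _ = _ := by ring

/-- Along a path at most `A_k · n` sets are added (all have size `≤ k`).
[cite: ImpagliazzoPaturiZaneJCSS2001, §2 Lemma 5 and proof of Lemma 7] -/
theorem Inv.card_add_le (hσ : Inv k M S₀ σ) (hS : ∀ s ∈ S₀, s.card ≤ k) :
    σ.add.card ≤ abnd M k * Fintype.card α := by
  have : σ.add = σ.add.filter fun e => e.card ≤ k := by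
    refine (filter_true_of_mem fun e he => ?_).symm
    obtain ⟨t, ht, het⟩ := hσ.subset_orig e (mem_union_right _ he)
    exact (card_le_card het).trans (hS t ht)
  rw [this]; exact hσ.card_add_filter_le k

/-- **Lemma 6, per petal size.** Along a path at most `⌊n / M⌋` petal steps have petal size `i`
(each contributes `θ_i = M · incr_{i-1}` new `i`-sets, of which there are `≤ incr_{i-1} · n`).
[cite: ImpagliazzoPaturiZaneJCSS2001, §2 Lemma 6] -/
theorem Inv.count_le (hσ : Inv k M S₀ σ) (hM : 1 ≤ M) (i : ℕ) :
    σ.ps.count i ≤ Fintype.card α / M := by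
  rcases Nat.eq_zero_or_pos (σ.ps.count i) with h0 | hpos
  · rw [h0]; exact Nat.zero_le _
  · have hi : 1 ≤ i := (hσ.ps_bound i (List.count_pos_iff.1 hpos)).1
    obtain ⟨j, rfl⟩ : ∃ j, i = j + 1 := ⟨i - 1, by omega⟩
    have h1 := hσ.theta_mul_count_le (j + 1)
    have h2 := hσ.card_add_filter_eq_le (i := j + 1) (by omega)
    have h3 := hσ.card_add_filter_le j
    have hlt : (σ.add.filter fun e => e.card < j + 1) = (σ.add.filter fun e => e.card ≤ j) :=
      filter_congr fun e _ => Nat.lt_succ_iff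
    rw [hlt] at h2
    rw [theta_succ, incr_eq] at h1
    have key : M * (jb M (j + 1) * (1 + abnd M j)) * σ.ps.count (j + 1) ≤
        (jb M (j + 1) * (1 + abnd M j)) * Fintype.card α := by
      refine h1.trans (h2.trans ?_)
      calc jb M (j + 1) * (Fintype.card α + (σ.add.filter fun e => e.card ≤ j).card)
          ≤ jb M (j + 1) * (Fintype.card α + abnd M j * Fintype.card α) :=
            Nat.mul_le_mul_left _ (Nat.add_le_add_left h3 _)
        _ = _ := by ring
    have hpos' : 0 < jb M (j + 1) * (1 + abnd M j) := Nat.mul_pos (one_le_jb hM _) (by omega)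
    rw [Nat.le_div_iff_mul_le (by omega)]
    refine Nat.le_of_mul_le_mul_left ?_ hpos'
    calc jb M (j + 1) * (1 + abnd M j) * (σ.ps.count (j + 1) * M)
        = M * (jb M (j + 1) * (1 + abnd M j)) * σ.ps.count (j + 1) := by ring
      _ ≤ (jb M (j + 1) * (1 + abnd M j)) * Fintype.card α := key

/-- **Lemma 6.** Along a path there are at most `k · ⌊n / M⌋` petal steps.
[cite: ImpagliazzoPaturiZaneJCSS2001, §2 Lemma 6] -/
theorem Inv.length_ps_le (hσ : Inv k M S₀ σ) (hM : 1 ≤ M) :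
    σ.ps.length ≤ k * (Fintype.card α / M) := by
  classical
  rw [← List.sum_toFinset_count_eq_length]
  have hsub : σ.ps.toFinset ⊆ Finset.range k := fun i hi =>
    mem_range.2 (hσ.ps_bound i (List.mem_toFinset.1 hi)).2
  calc ∑ a ∈ σ.ps.toFinset, σ.ps.count a ≤ ∑ _a ∈ σ.ps.toFinset, Fintype.card α / M :=
        sum_le_sum fun a _ => hσ.count_le hM a
    _ = σ.ps.toFinset.card * (Fintype.card α / M) := by rw [sum_const, smul_eq_mul]
    _ ≤ k * (Fintype.card α / M) :=
        Nat.mul_le_mul_right _ ((card_le_card hsub).trans (by simp))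

/-! ### Lemma 7: counting leaves -/

/-- **Lemma 7 (generating-function form).** For `y ≥ 1`, the number of leaves below a node is at
most `(1 + 1/y)^(adds left) · y^(petal steps left)`, where along any path at most `A_k · n` sets
are added and at most `k⌊n/M⌋` petal steps occur: a heart step uses one addition, a petal step
uses at least one addition and one petal step, and `u^{a-1} y^{c} + u^{a-1} y^{c-1} = u^a y^c`
for `u = 1 + 1/y`. (The printed proof counts the same paths by `∑_{r ≤ P} binom(D, r)`.)
[cite: ImpagliazzoPaturiZaneJCSS2001, §2 Lemma 7] -/
theorem length_run_le (hS : ∀ s ∈ S₀, s.card ≤ k) (hM : 1 ≤ M)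
    {step : List Bool → Finset (Finset α) → Option (Branch α)}
    (hstep : ∀ p, IsValidStep (theta M) (step p)) {y : ℝ} (hy : 1 ≤ y) :
    ∀ (fuel : ℕ) (p : List Bool) (σ : State α), Inv k M S₀ σ →
      ((run step fuel p σ).length : ℝ) ≤
        (1 + 1 / y) ^ ((abnd M k * Fintype.card α : ℕ) - σ.add.card : ℤ) *
          y ^ ((k * (Fintype.card α / M) : ℕ) - σ.ps.length : ℤ) := by
  have hu : (1 : ℝ) ≤ 1 + 1 / y := le_add_of_nonneg_right (by positivity)
  have hy0 : (0 : ℝ) < y := by linarith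
  have hu0 : (0 : ℝ) < 1 + 1 / y := by linarith
  have leaf : ∀ σ : State α, Inv k M S₀ σ → (([σ].length : ℕ) : ℝ) ≤
      (1 + 1 / y) ^ ((abnd M k * Fintype.card α : ℕ) - σ.add.card : ℤ) *
        y ^ ((k * (Fintype.card α / M) : ℕ) - σ.ps.length : ℤ) := by
    intro σ hσ
    have h1 := hσ.card_add_le hS
    have h2 := hσ.length_ps_le hM
    rw [List.length_singleton, Nat.cast_one]
    exact one_le_mul_of_one_le_of_one_le (one_le_zpow₀ hu (by omega))
      (one_le_zpow₀ hy (by omega))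
  intro fuel
  induction fuel with
  | zero => intro p σ hσ; exact leaf σ hσ
  | succ f ih =>
    intro p σ hσ
    cases h : step p σ.cur with
    | none => rw [run_succ_of_none h]; exact leaf σ hσ
    | some b =>
      obtain ⟨hb, hmin⟩ := (hstep p σ.cur).2 b h
      have hθ1 := one_le_theta hM b.i
      have ihH := ih (false :: p) _ (hσ.heartChild hM hb hmin)
      have ihP := ih (true :: p) _ (hσ.petalChild hS hM hb hmin)
      have hdisjH : Disjoint σ.add {b.H} := hσ.disjoint_add fun n hn => by
        rw [mem_singleton] at hn; rw [hn]; exact fresh_heart hσ.antichain hb hθ1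
      have hcardH : (σ.heartChild b).add.card = σ.add.card + 1 := by
        show (σ.add ∪ {b.H}).card = _
        rw [card_union_of_disjoint hdisjH, card_singleton]
      have hdisjP : Disjoint σ.add b.petals := hσ.disjoint_add (fresh_petals hσ.antichain hb)
      have hcardP : σ.add.card + 1 ≤ (σ.petalChild b).add.card := by
        show _ ≤ (σ.add ∪ b.petals).card
        rw [card_union_of_disjoint hdisjP, Branch.card_petals hb]
        have := hb.2.2.2.1
        omega
      have hpsH : (σ.heartChild b).ps = σ.ps := rfl
      have hpsP : (σ.petalChild b).ps.length = σ.ps.length + 1 := rfl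
      rw [hcardH, hpsH] at ihH
      rw [hpsP] at ihP
      rw [run_succ_of_some h, List.length_append, Nat.cast_add]
      set D : ℤ := ((abnd M k * Fintype.card α : ℕ) : ℤ) with hD
      set P : ℤ := ((k * (Fintype.card α / M) : ℕ) : ℤ) with hP
      set u : ℝ := 1 + 1 / y with hu_def
      have ihP' : ((run step f (true :: p) (σ.petalChild b)).length : ℝ) ≤
          u ^ (D - (σ.add.card + 1 : ℕ)) * y ^ (P - (σ.ps.length + 1 : ℕ)) := by
        refine ihP.trans (mul_le_mul_of_nonneg_right
          (zpow_le_zpow_right₀ hu (by push_cast; omega)) (zpow_nonneg hy0.le _))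
      refine (add_le_add ihH ihP').trans (le_of_eq ?_)
      have e1 : u ^ (D - (σ.add.card + 1 : ℕ)) = u ^ (D - σ.add.card) * u⁻¹ := by
        rw [← zpow_sub_one₀ hu0.ne']; congr 1; push_cast; ring
      have e2 : y ^ (P - (σ.ps.length + 1 : ℕ)) = y ^ (P - σ.ps.length) * y⁻¹ := by
        rw [← zpow_sub_one₀ hy0.ne']; congr 1; push_cast; ring
      have hyu : 1 + y⁻¹ = u := by rw [hu_def, one_div]
      rw [e1, e2]
      calc u ^ (D - σ.add.card) * u⁻¹ * y ^ (P - σ.ps.length) +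
            u ^ (D - σ.add.card) * u⁻¹ * (y ^ (P - σ.ps.length) * y⁻¹)
          = u ^ (D - σ.add.card) * y ^ (P - σ.ps.length) * (u⁻¹ * (1 + y⁻¹)) := by ring
        _ = _ := by rw [hyu, inv_mul_cancel₀ hu0.ne', mul_one]

/-! ### Termination: with fuel `2^n + 1` every leaf is sunflower-free -/

/-- The number of subsets of the universe containing no member of `F`; it drops at every
branching. [folklore] -/
def freeCount (F : Finset (Finset α)) : ℕ :=
  ((univ : Finset (Finset α)).filter fun X => ∀ c ∈ F, ¬ c ⊆ X).card

/-- `freeCount F ≤ 2^n`. [folklore] -/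
theorem freeCount_le (F : Finset (Finset α)) : freeCount F ≤ 2 ^ Fintype.card α :=
  (card_filter_le _ _).trans (by rw [card_univ, Fintype.card_finset])

/-- Adding fresh sets strictly decreases `freeCount`. [folklore] -/
theorem freeCount_lt {F N : Finset (Finset α)} (hfresh : ∀ n ∈ N, ∀ c ∈ F, ¬ c ⊆ n)
    (hN : N.Nonempty) : freeCount (minimals (F ∪ N)) < freeCount F := by
  obtain ⟨n₀, hn₀⟩ := hN
  have hsub :
      ((univ : Finset (Finset α)).filter fun X => ∀ c ∈ minimals (F ∪ N), ¬ c ⊆ X) ⊆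
      (univ : Finset (Finset α)).filter fun X => ∀ c ∈ F, ¬ c ⊆ X := by
    intro X hX
    simp only [mem_filter, mem_univ, true_and] at hX ⊢
    intro c hc hcX
    obtain ⟨c', hc', hc'c⟩ := exists_mem_minimals_subset (mem_union_left N hc)
    exact hX c' hc' (hc'c.trans hcX)
  refine card_lt_card ((ssubset_iff_of_subset hsub).2 ⟨n₀, ?_, fun h => ?_⟩)
  · exact mem_filter.2 ⟨mem_univ _, fun c hc => hfresh n₀ hn₀ c hc⟩
  · obtain ⟨c', hc', hc'n⟩ := exists_mem_minimals_subset (mem_union_right F hn₀)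
    exact (mem_filter.1 h).2 c' hc' hc'n

/-- With more fuel than `freeCount`, every leaf of `run` is sunflower-free (the selection rule
returned `none` there, so no weak sunflower qualifies).
[cite: ImpagliazzoPaturiZaneJCSS2001, §2 (Reduce halts)] -/
theorem run_terminal (hS : ∀ s ∈ S₀, s.card ≤ k) (hM : 1 ≤ M)
    {step : List Bool → Finset (Finset α) → Option (Branch α)}
    (hstep : ∀ p, IsValidStep (theta M) (step p)) :
    ∀ (fuel : ℕ) (p : List Bool) (σ : State α), Inv k M S₀ σ → freeCount σ.cur < fuel →
      ∀ τ ∈ run step fuel p σ, ∀ b, ¬ Qual (theta M) τ.cur b := by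
  intro fuel
  induction fuel with
  | zero => intro p σ _ h; exact absurd h (Nat.not_lt_zero _)
  | succ f ih =>
    intro p σ hσ hlt τ hτ
    cases h : step p σ.cur with
    | none =>
      rw [run_succ_of_none h, List.mem_singleton] at hτ; rw [hτ]; exact (hstep p σ.cur).1 h
    | some b =>
      obtain ⟨hb, hmin⟩ := (hstep p σ.cur).2 b h
      rw [run_succ_of_some h, List.mem_append] at hτ
      have hθ1 := one_le_theta hM b.i
      rcases hτ with hτ | hτ
      · refine ih _ _ (hσ.heartChild hM hb hmin) ?_ τ hτ
        have := freeCount_lt (F := σ.cur) (N := {b.H}) (fun n hn => by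
          rw [mem_singleton] at hn; rw [hn]; exact fresh_heart hσ.antichain hb hθ1)
          (singleton_nonempty _)
        exact lt_of_lt_of_le this (Nat.lt_succ_iff.1 hlt)
      · refine ih _ _ (hσ.petalChild hS hM hb hmin) ?_ τ hτ
        have := freeCount_lt (fresh_petals hσ.antichain hb)
          (by rw [← card_pos, Branch.card_petals hb]; exact lt_of_lt_of_le hθ1 hb.2.2.2.1)
        exact lt_of_lt_of_le this (Nat.lt_succ_iff.1 hlt)

/-! ### Lemma 2: sunflower-free families are sparse -/

/-- **Lemma 2.** A sunflower-free family of sets of size `≤ k` has at most `(∑_{j<k} θ_j) · n`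
nonempty members: an element in `θ_{j-1}` sets of size `j ≥ 2` would give a qualifying sunflower
with heart `{x}`, and there are at most `n` singletons.
[cite: ImpagliazzoPaturiZaneJCSS2001, §2 Lemma 2] -/
theorem card_filter_nonempty_le_of_terminal {θ : ℕ → ℕ} (hθ : ∀ i, 1 ≤ θ i)
    {F : Finset (Finset α)} (hnone : ∀ b, ¬ Qual θ F b) (hk : ∀ s ∈ F, s.card ≤ k) :
    (F.filter fun s => s.Nonempty).card ≤ (∑ j ∈ range k, θ j) * Fintype.card α := by
  have hsub : (F.filter fun s => s.Nonempty) ⊆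
      (range k).biUnion fun j => F.filter fun s => s.card = j + 1 := by
    intro s hs
    simp only [mem_filter] at hs
    have h1 := hs.2.card_pos
    have h2 := hk s hs.1
    exact mem_biUnion.2 ⟨s.card - 1, mem_range.2 (by omega), mem_filter.2 ⟨hs.1, by omega⟩⟩
  have hlev : ∀ j, (F.filter fun s => s.card = j + 1).card ≤ θ j * Fintype.card α := by
    intro j
    refine card_le_mul_of_deg_le (fun s hs => ?_) (fun x => ?_)
    · simp only [mem_filter] at hs; exact card_pos.1 (by omega)
    · rw [filter_filter]
      rcases Nat.eq_zero_or_pos j with hj | hj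
      · subst hj
        exact (card_le_card (filter_card_eq_one_subset F x)).trans
          (by rw [card_singleton]; exact hθ 0)
      · have := card_filter_le_of_terminal hnone (h := j + 1) (by omega) x
        simp only [Nat.add_sub_cancel] at this
        omega
  calc _ ≤ _ := card_le_card hsub
    _ ≤ ∑ j ∈ range k, (F.filter fun s => s.card = j + 1).card := card_biUnion_le
    _ ≤ ∑ j ∈ range k, θ j * Fintype.card α := sum_le_sum fun j _ => hlev j
    _ = _ := by rw [sum_mul]

/-! ### Choice of the parameters -/

/-- Crude growth bound: `θ_i, A_i ≤ (4M)^(2^i - 1)` for `M ≥ 2`. [folklore] -/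
theorem theta_abnd_le_pow {M : ℕ} (hM : 2 ≤ M) :
    ∀ i, theta M i ≤ (4 * M) ^ (2 ^ i - 1) ∧ abnd M i ≤ (4 * M) ^ (2 ^ i - 1)
  | 0 => by simp [theta_zero, abnd_zero]
  | i + 1 => by
    obtain ⟨h1, h2⟩ := theta_abnd_le_pow hM i
    set T := (4 * M) ^ (2 ^ i - 1) with hT
    have hT1 : 1 ≤ T := Nat.one_le_pow _ _ (by omega)
    have hpow : (4 * M) ^ (2 ^ (i + 1) - 1) = 4 * M * T * T := by
      have : 2 ^ (i + 1) - 1 = 1 + ((2 ^ i - 1) + (2 ^ i - 1)) := by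
        have := Nat.one_le_two_pow (n := i); rw [pow_succ]; omega
      rw [this, pow_add, pow_one, pow_add]; ring
    rw [hpow, theta_succ, abnd_succ, incr]
    have h3 : 2 * theta M i - 1 ≤ 2 * T := by omega
    have h4 : 1 + abnd M i ≤ 2 * T := by omega
    have h5 : 2 * (T * T) ≤ M * (T * T) := Nat.mul_le_mul_right _ hM
    have h6 : T ≤ T * T := Nat.le_mul_self T
    constructor
    · calc M * ((2 * theta M i - 1) * (1 + abnd M i)) ≤ M * (2 * T * (2 * T)) :=
          Nat.mul_le_mul_left _ (Nat.mul_le_mul h3 h4)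
        _ = 4 * M * T * T := by ring
    · calc abnd M i + (2 * theta M i - 1) * (1 + abnd M i) ≤ T + 2 * T * (2 * T) :=
          add_le_add h2 (Nat.mul_le_mul h3 h4)
        _ ≤ 4 * M * T * T := by nlinarith [h5, h6]

/-- **The final estimate** (end of the proof of Lemma 7): for `k` and `ε > 0` there are `M ≥ 2`
and `y ≥ 1` with `(1 + 1/y)^{A_k n} · y^{k⌊n/M⌋} ≤ 2^{ε n}` for all `n`
(take `y = 2^{ε M/2k}` and `M` with `(4M)^{2^k} · 2^{-ε M/2k} ≤ (ε/2) ln 2`).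
[cite: ImpagliazzoPaturiZaneJCSS2001, §2 (proof of Lemma 7, "the last by our choice of α")] -/
theorem exists_good_params (k : ℕ) {ε : ℝ} (hε : 0 < ε) :
    ∃ M : ℕ, 2 ≤ M ∧ ∃ y : ℝ, 1 ≤ y ∧ ∀ n : ℕ,
      (1 + 1 / y) ^ (abnd M k * n) * y ^ (k * (n / M)) ≤ (2 : ℝ) ^ (ε * n) := by
  rcases Nat.eq_zero_or_pos k with hk | hk
  · subst hk
    refine ⟨2, le_rfl, 1, le_rfl, fun n => ?_⟩
    simp only [abnd_zero, zero_mul, pow_zero, mul_one]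
    exact Real.one_le_rpow (by norm_num) (by positivity)
  · set r : ℝ := (2 : ℝ) ^ (ε / (2 * k)) with hr
    have hk0 : (0 : ℝ) < k := by exact_mod_cast hk
    have hr1 : 1 < r := Real.one_lt_rpow (by norm_num) (by positivity)
    have hr0 : 0 < r := by linarith
    have hlog : 0 < Real.log 2 := Real.log_pos (by norm_num)
    set c : ℝ := ε * Real.log 2 / 2 / (4 : ℝ) ^ (2 ^ k) with hc_def
    have hc : 0 < c := div_pos (div_pos (mul_pos hε hlog) two_pos) (by positivity)
    have hd := tendsto_pow_const_div_const_pow_of_one_lt (2 ^ k) hr1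
    have hev : ∀ᶠ M : ℕ in Filter.atTop, (M : ℝ) ^ (2 ^ k) / r ^ M ≤ c :=
      hd.eventually_le_const hc
    obtain ⟨M, hMle, hM2⟩ := (hev.and (Filter.eventually_ge_atTop 2)).exists
    have hM0 : (0 : ℝ) < M := by exact_mod_cast (show 0 < M by omega)
    refine ⟨M, hM2, r ^ M, one_le_pow₀ hr1.le, fun n => ?_⟩
    have hy0 : (0 : ℝ) < r ^ M := pow_pos hr0 M
    -- the petal factor
    have hP : (r ^ M) ^ (k * (n / M)) ≤ (2 : ℝ) ^ (ε * n / 2) := by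
      rw [← pow_mul]
      have hle : M * (k * (n / M)) ≤ k * n := by
        have := Nat.div_mul_le_self n M
        calc M * (k * (n / M)) = k * (n / M * M) := by ring
          _ ≤ k * n := Nat.mul_le_mul_left _ this
      calc r ^ (M * (k * (n / M))) ≤ r ^ (k * n) := pow_le_pow_right₀ hr1.le hle
        _ = (2 : ℝ) ^ (ε * n / 2) := by
          rw [hr, ← Real.rpow_natCast, ← Real.rpow_mul (by norm_num)]
          congr 1
          push_cast
          field_simp
    -- the heart factor
    have hA : (abnd M k : ℝ) ≤ (4 * M : ℝ) ^ (2 ^ k) := by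
      have := (theta_abnd_le_pow hM2 k).2.trans
        (Nat.pow_le_pow_right (show 0 < 4 * M by omega) (Nat.sub_le (2 ^ k) 1))
      exact_mod_cast this
    have hH : (1 + 1 / r ^ M) ^ (abnd M k * n) ≤ (2 : ℝ) ^ (ε * n / 2) := by
      have h1 : (1 + 1 / r ^ M) ^ (abnd M k * n) ≤ Real.exp (1 / r ^ M) ^ (abnd M k * n) :=
        pow_le_pow_left₀ (by positivity) (by linarith [Real.add_one_le_exp (1 / r ^ M)]) _
      refine h1.trans ?_
      rw [← Real.exp_nat_mul, Real.rpow_def_of_pos (by norm_num : (0 : ℝ) < 2)]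
      refine Real.exp_le_exp.2 ?_
      -- (A n) / r^M ≤ log 2 * (ε n / 2)
      have hMc : (M : ℝ) ^ (2 ^ k) / r ^ M ≤ c := hMle
      have key : (abnd M k : ℝ) / r ^ M ≤ ε * Real.log 2 / 2 := by
        calc (abnd M k : ℝ) / r ^ M ≤ (4 * M : ℝ) ^ (2 ^ k) / r ^ M :=
              div_le_div_of_nonneg_right hA hy0.le
          _ = (4 : ℝ) ^ (2 ^ k) * ((M : ℝ) ^ (2 ^ k) / r ^ M) := by rw [mul_pow]; ring
          _ ≤ (4 : ℝ) ^ (2 ^ k) * c := mul_le_mul_of_nonneg_left hMc (by positivity)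
          _ = ε * Real.log 2 / 2 := by rw [hc_def]; field_simp
      have hn : (0 : ℝ) ≤ n := Nat.cast_nonneg n
      calc ((abnd M k * n : ℕ) : ℝ) * (1 / r ^ M) = (abnd M k : ℝ) / r ^ M * n := by
            push_cast; ring
        _ ≤ ε * Real.log 2 / 2 * n := mul_le_mul_of_nonneg_right key hn
        _ = Real.log 2 * (ε * n / 2) := by ring
    calc (1 + 1 / r ^ M) ^ (abnd M k * n) * (r ^ M) ^ (k * (n / M))
        ≤ (2 : ℝ) ^ (ε * n / 2) * (2 : ℝ) ^ (ε * n / 2) :=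
          mul_le_mul hH hP (by positivity) (by positivity)
      _ = (2 : ℝ) ^ (ε * n) := by rw [← Real.rpow_add (by norm_num)]; ring_nf

/-! ### Theorem 1 -/

/-- **Sparsification lemma, set-cover form (Theorem 1 of IPZ, existence part).** For all `k` and
`ε > 0` there is a constant `C` such that for every family `S` of sets of size at most `k` over a
finite universe of size `n` there is a list of at most `2^{ε n}` families `T₁, …, T_t` with:
each `T_l` has at most `C · n` members, is a restriction of `S` (every member of `S` contains a
member of `T_l`), consists of subsets of members of `S`, and `σ(S) = ⋃_l σ(T_l)` (a set covers `S`
iff it covers some `T_l`). The printed theorem moreover asserts that the list is produced by an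
algorithm running in time `poly(n) 2^{ε n}`; that part is not formalised (no time-bounded machine
model for it in Mathlib). For `∅ ∈ S` the list is empty (no covers).
[cite: ImpagliazzoPaturiZaneJCSS2001, Theorem 1] -/
theorem IPZ2001_theorem1 (k : ℕ) {ε : ℝ} (hε : 0 < ε) :
    ∃ C : ℕ, ∀ (β : Type*) [Fintype β] [DecidableEq β] (S : Finset (Finset β)),
      (∀ s ∈ S, s.card ≤ k) →
      ∃ L : List (Finset (Finset β)),
        (L.length : ℝ) ≤ (2 : ℝ) ^ (ε * Fintype.card β) ∧
        (∀ T ∈ L, T.card ≤ C * Fintype.card β ∧ (∀ s ∈ S, ∃ t ∈ T, t ⊆ s) ∧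
          ∀ t ∈ T, ∃ s ∈ S, t ⊆ s) ∧
        ∀ X : Finset β, Covers X S ↔ ∃ T ∈ L, Covers X T := by
  obtain ⟨M, hM2, y, hy, hnum⟩ := exists_good_params k hε
  have hM : 1 ≤ M := by omega
  refine ⟨∑ j ∈ range k, theta M j, ?_⟩
  intro β _ _ S hS
  by_cases h0 : ∅ ∈ S
  · refine ⟨[], by simpa using Real.rpow_nonneg (by norm_num : (0 : ℝ) ≤ 2) _, by simp,
      fun X => ?_⟩
    simp only [List.not_mem_nil, false_and, exists_false, iff_false]
    intro hX
    simpa using hX ∅ h0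
  · obtain ⟨step₀, hstep₀⟩ := exists_isValidStep (α := β) (theta M)
    set step : List Bool → Finset (Finset β) → Option (Branch β) := fun _ => step₀ with hstep_def
    have hstep : ∀ p, IsValidStep (theta M) (step p) := fun _ => hstep₀
    have hroot := Inv.root k M S
    have hInv : ∀ τ ∈ run step (2 ^ Fintype.card β + 1) [] (root S), Inv k M S τ :=
      forall_mem_run (fun p σ b hσ h =>
        ⟨hσ.heartChild hM ((hstep p _).2 b h).1 ((hstep p _).2 b h).2,
          hσ.petalChild hS hM ((hstep p _).2 b h).1 ((hstep p _).2 b h).2⟩) _ _ _ hroot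
    have hterm : ∀ τ ∈ run step (2 ^ Fintype.card β + 1) [] (root S),
        ∀ b, ¬ Qual (theta M) τ.cur b :=
      run_terminal hS hM hstep _ _ _ hroot (Nat.lt_succ_of_le (freeCount_le _))
    refine ⟨(run step (2 ^ Fintype.card β + 1) [] (root S)).map State.cur, ?_, ?_, ?_⟩
    · rw [List.length_map]
      have h := length_run_le hS hM hstep hy (2 ^ Fintype.card β + 1) [] (root S) hroot
      rw [show (root S).add.card = 0 from rfl, show (root S).ps.length = 0 from rfl] at h
      simp only [Nat.cast_zero, sub_zero, zpow_natCast] at h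
      exact h.trans (hnum _)
    · intro T hT
      obtain ⟨τ, hτ, rfl⟩ := List.mem_map.1 hT
      have hI := hInv τ hτ
      refine ⟨?_, fun s hs => hI.exists_subset s (mem_union_left _ hs),
        fun t ht => hI.subset_orig t (mem_union_left _ ht)⟩
      have hne : ∀ s ∈ τ.cur, s.Nonempty := by
        intro s hs
        rcases mem_union.1 (hI.cur_subset hs) with h | h
        · exact nonempty_iff_ne_empty.2 fun he => h0 (he ▸ h)
        · exact hI.add_nonempty s h
      rw [← filter_true_of_mem hne]
      refine card_filter_nonempty_le_of_terminal (one_le_theta hM) (hterm τ hτ) fun s hs => ?_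
      obtain ⟨t, ht, hst⟩ := hI.subset_orig s (mem_union_left _ hs)
      exact (card_le_card hst).trans (hS t ht)
    · intro X
      have h := covers_iff_exists_leaf hstep X (2 ^ Fintype.card β + 1) [] (root S)
      rw [show (root S).cur = minimals S from rfl, covers_minimals_iff] at h
      rw [h]
      simp only [List.mem_map, exists_exists_and_eq_and]

end Bounds

end Sparsification

/-! ### Corollary 1: k-CNF formulas -/

namespace KCNF

variable {k : ℕ}

/-- The set of literals of a clause, as a finset over the `2n` literals `Fin n × Bool`.
[cite: ImpagliazzoPaturiZaneJCSS2001, §2 ("for each clause, the set of its literals")] -/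
def litSet (n : ℕ) (c : List (ℕ × Bool)) : Finset (Fin n × Bool) :=
  univ.filter fun a => ((a.1 : ℕ), a.2) ∈ c

/-- The set-cover instance of a k-CNF: the literal sets of its clauses (the auxiliary pairs
`{x, x̄}` of the printed reduction are not needed).
[cite: ImpagliazzoPaturiZaneJCSS2001, §2 (k-SAT as k-Set Cover)] -/
def family (φ : KCNF k) : Finset (Finset (Fin φ.numVars × Bool)) :=
  (φ.clauses.map (litSet φ.numVars)).toFinset

/-- The set of true literals of an assignment. [folklore] -/
def trueLits (n : ℕ) (v : ℕ → Bool) : Finset (Fin n × Bool) :=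
  univ.filter fun a => v a.1 = a.2

/-- A finset of literals read back as a clause. [folklore] -/
noncomputable def toClause {n : ℕ} (s : Finset (Fin n × Bool)) : List (ℕ × Bool) :=
  s.toList.map fun a => ((a.1 : ℕ), a.2)

/-- A family of literal sets read back as a k-CNF on `n` variables (sets of more than `k`
literals, which do not occur in our use, are dropped). [folklore] -/
noncomputable def ofFamily (k : ℕ) {n : ℕ} (T : Finset (Finset (Fin n × Bool))) : KCNF k where
  numVars := n
  clauses := (T.filter fun t => t.card ≤ k).toList.map toClause
  fst_lt_numVars := by
    intro c hc l hl
    simp only [List.mem_map, Finset.mem_toList] at hc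
    obtain ⟨t, -, rfl⟩ := hc
    simp only [toClause, List.mem_map, Finset.mem_toList] at hl
    obtain ⟨a, -, rfl⟩ := hl
    exact a.1.isLt
  length_le := by
    intro c hc
    simp only [List.mem_map, Finset.mem_toList, Finset.mem_filter] at hc
    obtain ⟨t, ⟨-, ht⟩, rfl⟩ := hc
    simpa [toClause] using ht

/-- Semantics of a read-back clause. [folklore] -/
theorem any_toClause {n : ℕ} (s : Finset (Fin n × Bool)) (v : ℕ → Bool) :
    (toClause s).any (fun l => v l.1 == l.2) = true ↔ ∃ a ∈ s, v a.1 = a.2 := by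
  simp [toClause, List.any_eq_true]

/-- Semantics of a read-back family. [folklore] -/
theorem eval_ofFamily {n : ℕ} {T : Finset (Finset (Fin n × Bool))} (hT : ∀ t ∈ T, t.card ≤ k)
    (v : ℕ → Bool) : (ofFamily k T).eval v = true ↔ ∀ t ∈ T, ∃ a ∈ t, v a.1 = a.2 := by
  have hfilter : (T.filter fun t => t.card ≤ k) = T := filter_true_of_mem hT
  simp only [KCNF.eval, ofFamily, hfilter, List.all_eq_true, List.mem_map, Finset.mem_toList,
    forall_exists_index, and_imp, forall_apply_eq_imp_iff₂, any_toClause]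

/-- Semantics of a clause through its literal set. [folklore] -/
theorem any_iff_exists_mem_litSet {n : ℕ} {c : List (ℕ × Bool)} (hc : ∀ l ∈ c, l.1 < n)
    (v : ℕ → Bool) : c.any (fun l => v l.1 == l.2) = true ↔ ∃ a ∈ litSet n c, v a.1 = a.2 := by
  simp only [List.any_eq_true, beq_iff_eq, litSet, mem_filter, mem_univ, true_and]
  constructor
  · rintro ⟨l, hl, hv⟩
    exact ⟨(⟨l.1, hc l hl⟩, l.2), by simpa using hl, by simpa using hv⟩
  · rintro ⟨a, ha, hv⟩
    exact ⟨_, ha, hv⟩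

/-- Covering by the true literals is satisfaction. [folklore] -/
theorem covers_trueLits_iff {n : ℕ} (v : ℕ → Bool) (T : Finset (Finset (Fin n × Bool))) :
    Sparsification.Covers (trueLits n v) T ↔ ∀ t ∈ T, ∃ a ∈ t, v a.1 = a.2 := by
  simp only [Sparsification.Covers, Finset.Nonempty, mem_inter, trueLits, mem_filter, mem_univ,
    true_and]

/-- A k-CNF is satisfied by `v` iff the true literals of `v` cover its set-cover instance.
[cite: ImpagliazzoPaturiZaneJCSS2001, §2 (k-SAT as k-Set Cover)] -/
theorem eval_iff_covers (φ : KCNF k) (v : ℕ → Bool) :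
    φ.eval v = true ↔ Sparsification.Covers (trueLits φ.numVars v) φ.family := by
  rw [covers_trueLits_iff]
  simp only [KCNF.eval, List.all_eq_true, family, List.mem_toFinset, List.mem_map,
    forall_exists_index, and_imp, forall_apply_eq_imp_iff₂]
  refine forall₂_congr fun c hc => ?_
  exact any_iff_exists_mem_litSet (φ.fst_lt_numVars c hc) v

/-- A literal set has at most as many elements as the clause has literals. [folklore] -/
theorem card_litSet_le {n : ℕ} (c : List (ℕ × Bool)) : (litSet n c).card ≤ c.length := by
  classical
  refine le_trans (Finset.card_le_card_of_injOn (fun a : Fin n × Bool => ((a.1 : ℕ), a.2))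
    ?_ ?_) (List.toFinset_card_le c)
  · intro a ha
    have ha' : a ∈ litSet n c := by simpa using ha
    simp only [litSet, mem_filter, mem_univ, true_and] at ha'
    simpa using ha'
  · intro a _ b _ h
    simp only [Prod.mk.injEq] at h
    exact Prod.ext (Fin.ext h.1) h.2

end KCNF

/-- **Sparsification lemma for k-SAT (Corollary 1 of IPZ, existence part).** For all `k` and
`ε > 0` there is a constant `C` and a function `F` assigning to every k-CNF `φ` on `n` variables
a list of at most `2^{ε n}` k-CNFs on the same `n` variables, each with at most `C · n` clauses,
whose disjunction is equivalent to `φ`. This is *verbatim* the first conjunct of the named fact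
`sparsification` (**fine-grained.S05**); the remaining conjunct there — that `F` is computable in
time `2^{ε n} · poly(L)` on a multi-stack Turing machine, the "Moreover" sentence of the printed
corollary — is not asserted here. Proved below (`IPZ2001_corollary1_holds`).
[cite: ImpagliazzoPaturiZaneJCSS2001, Corollary 1] -/
def IPZ2001_corollary1 : Prop :=
  ∀ (k : ℕ) (ε : ℝ) (_hε : 0 < ε),
    ∃ (C : ℕ) (F : KCNF k → List (KCNF k)),
      ∀ φ : KCNF k,
        ((F φ).length : ℝ) ≤ (2 : ℝ) ^ (ε * φ.numVars) ∧
        (∀ ψ ∈ F φ, ψ.numVars = φ.numVars ∧ ψ.clauses.length ≤ C * φ.numVars) ∧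
        ∀ v : ℕ → Bool, φ.eval v = true ↔ ∃ ψ ∈ F φ, ψ.eval v = true

/-- `sparsification` (the named fact, with its time bound) contains Corollary 1. [folklore] -/
theorem IPZ2001_corollary1_of_sparsification (h : sparsification) : IPZ2001_corollary1 := by
  intro k ε hε
  obtain ⟨C, F, -, hF, -, -⟩ := h k ε hε
  exact ⟨C, F, hF⟩

/-- **Corollary 1 of IPZ (existence part), proved**: from Theorem 1 applied to the literal sets of
the clauses over the `2n` literals with `ε/2`, reading the output families back as k-CNFs and
discarding families containing the empty clause.
[cite: ImpagliazzoPaturiZaneJCSS2001, Corollary 1] -/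
theorem IPZ2001_corollary1_holds : IPZ2001_corollary1 := by
  intro k ε hε
  obtain ⟨C, hC⟩ := Sparsification.IPZ2001_theorem1.{0} k (half_pos hε)
  have hS : ∀ φ : KCNF k, ∀ s ∈ φ.family, s.card ≤ k := by
    intro φ s hs
    simp only [KCNF.family, List.mem_toFinset, List.mem_map] at hs
    obtain ⟨c, hc, rfl⟩ := hs
    exact (KCNF.card_litSet_le c).trans (φ.length_le c hc)
  choose L hL using fun φ : KCNF k => hC (Fin φ.numVars × Bool) φ.family (hS φ)
  have hcard : ∀ φ : KCNF k, Fintype.card (Fin φ.numVars × Bool) = 2 * φ.numVars := by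
    intro φ; simp [Fintype.card_prod, Fintype.card_bool, mul_comm]
  have hTk : ∀ φ : KCNF k, ∀ T ∈ L φ, ∀ t ∈ T, t.card ≤ k := by
    intro φ T hT t ht
    obtain ⟨s, hs, hts⟩ := ((hL φ).2.1 T hT).2.2 t ht
    exact (card_le_card hts).trans (hS φ s hs)
  refine ⟨2 * C, fun φ => ((L φ).filter fun T => ∅ ∉ T).map (KCNF.ofFamily k),
    fun φ => ⟨?_, ?_, ?_⟩⟩
  · have h1 := (hL φ).1
    rw [hcard φ] at h1
    rw [List.length_map]
    calc ((((L φ).filter fun T => ∅ ∉ T).length : ℕ) : ℝ) ≤ (L φ).length := by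
          exact_mod_cast List.length_filter_le _ _
      _ ≤ _ := h1
      _ = (2 : ℝ) ^ (ε * φ.numVars) := by congr 1; push_cast; ring
  · intro ψ hψ
    rw [List.mem_map] at hψ
    obtain ⟨T, hT, rfl⟩ := hψ
    rw [List.mem_filter] at hT
    refine ⟨rfl, ?_⟩
    have h2 := ((hL φ).2.1 T hT.1).1
    show ((T.filter fun t => t.card ≤ k).toList.map KCNF.toClause).length ≤ 2 * C * φ.numVars
    rw [List.length_map, Finset.length_toList]
    calc (T.filter fun t => t.card ≤ k).card ≤ T.card := card_filter_le _ _
      _ ≤ C * Fintype.card (Fin φ.numVars × Bool) := h2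
      _ = 2 * C * φ.numVars := by rw [hcard φ]; ring
  · intro v
    rw [KCNF.eval_iff_covers, (hL φ).2.2]
    constructor
    · rintro ⟨T, hT, hcov⟩
      have hT0 : ∅ ∉ T := fun h => by simpa using hcov ∅ h
      refine ⟨KCNF.ofFamily k T,
        List.mem_map.2 ⟨T, List.mem_filter.2 ⟨hT, by simpa using hT0⟩, rfl⟩, ?_⟩
      rw [KCNF.eval_ofFamily (hTk φ T hT)]
      rwa [KCNF.covers_trueLits_iff] at hcov
    · rintro ⟨ψ, hψ, hev⟩
      obtain ⟨T, hT, rfl⟩ := List.mem_map.1 hψ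
      rw [List.mem_filter] at hT
      refine ⟨T, hT.1, ?_⟩
      rw [KCNF.covers_trueLits_iff]
      rwa [KCNF.eval_ofFamily (hTk φ T hT.1)] at hev

end Literature.Computability.FineGrained
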